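import Mathlib
import Literature.NumberTheory.Sieve.ShnirelmanGoldbachShifts
import Literature.NumberTheory.Sieve.TwoResidueSelbergSumExplicit
import Literature.NumberTheory.Sieve.RomanoffExplicitAllN
import Literature.Combinatorics.Additive.MannTheorem
import Literature.NumberTheory.LFunctions.ChebyshevSylvesterPsi
import HarnessLib

/-!
# An explicit Shnirel'man–Goldbach theorem, continued (IV): every integer `> 1` is a sum of at most `47` primes (`53` → `47`)

Topic `Literature/NumberTheory/Sieve`; namespace `Literature.NumberTheory.Sieve.ShnirelmanGoldbachExplicit` (continued —
this is §22 of the story of `ShnirelmanGoldbachExplicit.lean` (§1–§12, `≤ 501`), `ShnirelmanGoldbachFlatten.lean`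
(§13–§15, `≤ 77`), `ShnirelmanGoldbachBonferroni.lean` (§16–§19, `≤ 59`) and `ShnirelmanGoldbachShifts.lean` (§20–§21,
`≤ 53`), kept in its own module because those files are at the gate's size cap).  Cell `parity-ideate` seat p5 g19,
ROUND-38 «CELLS» (`round38/SchnirelmannCells.lean` sha16 77bda103430a02cc, its §5, lines 3023–4341, with the needed §1,
§2 and §4.1 helper copies; its §A.2 = the enlarged cell polynomial `TlowK2` is §9 of `TwoResidueSelbergSumExplicit.lean`;
its §2–§3 = §19–§21 of the earlier modules), landed with statements and proofs verbatim (helpers `private`; the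
`private` helpers of the earlier modules it calls are re-proved here as verbatim `private` copies, as in the source).
The intermediate rung ROUND-37 «Q» (`round37/SchnirelmannQ.lean` sha16 24970f8d89cb91b1: the large-sieve LENGTH
`X = ⌊√N⌋/4 → ⌊√N⌋/c`, `51` unconditional / `45` under (3.3)) is subsumed: its length parameter `c` is built into
`explicit_of_largeSieve_kappa2_c` below.  No named facts, no definitions, no instances, no notation.

## References
* [Nathanson1996] M. B. Nathanson, *Additive Number Theory: The Classical Bases*, GTM 164 (1996), §7.3 Lemma 7.6,
  Lemma 7.7, Theorem 7.8, Theorem 7.9 (Goldbach–Shnirel'man).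
* [BatemanDiamond2004] P. T. Bateman, H. G. Diamond, *Analytic Number Theory: An Introductory Course* (2004), §13.4
  (13.13)–(13.14), Lemma 13.11, Theorem 13.8: the explicit large-sieve/Selberg step behind `explicit_of_largeSieve_kappa2_c`.
* [RosserSchoenfeld1962] J. B. Rosser, L. Schoenfeld, *Approximate formulas for some functions of prime numbers*,
  Illinois J. Math. 6 (1962), Theorem 2, eq. (3.3) (the conditional column's input).
* [Sylvester1892] J. J. Sylvester, *On arithmetical series*, Messenger of Math. 21 (1892), 1–19, 87–120.

## Content

* §22 the CELLS of the sieve main term: ONE input varied relative to §21 — the finite odd squarefull set behind the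
  κ-refined explicit two-residue Selberg sum, `{1,9,25,27,49,81}` (`TlowK = 0.3224 l² − …`) ↦ the 25 odd `19`-smooth
  squarefull `s ≤ 2048` (`TwoResidueSelbergExplicit.TlowK2 = 0.3529 l² − 1.2813 l + 1.2789`, `Qsum_ge_kappa2`, `X ≥ 2^18`),
  read through the explicit large-sieve step with a free LENGTH `X = ⌊√N⌋/c`, `4 ≤ c ≤ 40`
  (**`explicit_of_largeSieve_kappa2_c`**, `goldbachCount_le_of_numeric2_c`, `pairCount_le_of_numeric2_c`): the Goldbach
  sieve constant becomes `A = 12.04` at `e^352` (`c = 16`, `goldbachCount_le_1204`; §21 had `13.60` at `e^382`), the pair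
  sieves `16.93` above `e^41` (`c = 4`, `pairCount_le_1693`; tree `17.75`), `13.12` above `e^125` and `12.42` above `e^215`
  (`c = 8`, `pairCount_le_1312`, `pairCount_le_1242`), so the four-regime glue weights drop to `237.02 / 736.5 / 2407` and
  the glue holds with `h ≥ 23` (`half_count_ge_allN_cells`: one shift below `e^42.37`, four shifts on `[42.37, 125]`, seven
  on `[125, 215]`, twelve on `[215, 364]`), resp. `h ≥ 21` under (3.3) (`half_count_ge_allN_cells_RS`); at
  `(Λs, Λ₀, A) = (352, 364, 12.04)`: `x/46` even Goldbach numbers unconditionally (`goldbach_even_count_ge_46_exp364`,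
  `c₁ = 0.441`), `x/42` under (3.3) (`goldbach_even_count_ge_of_RS_42`, `c₁ = 0.4995`), `σ(B) ≥ 1/23` resp. `1/21`
  (`schnirelmannDensity_half_ge_23`, `schnirelmannDensity_half_ge_of_RS_21`), and
  **`schnirelmann_goldbach_le_47`** / **`schnirelmann_goldbach_of_RS_le_43`** (Mann: `2·23 + 1`, `2·21 + 1`): every `N ≥ 2`
  is a sum of at most `47` primes unconditionally, of at most `43` under Rosser–Schoenfeld (3.3).

Table of the series (K unconditional / under Rosser–Schoenfeld (3.3)): §9 4329/3121 → §10 1581/1141 → §11 791/571 →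
§12 501/379 → §13 379/289 → §14 113/105 → §15 77/65 → §16 65/55 → §17 63/53 → §18 61/51 → §19 59/51 → §20 57/51 →
§21 53/47 → (pub ROUND-37: 51/45) → §22 47/43.
Print calibration (NOT formalised, not used): Klimov 1975 (`55`), Vaughan 1977 (`27`), Deshouillers 1977 (`26`),
Riesel–Vaughan 1983 (`19`), Ramaré 1995 (even `n`: `≤ 6` primes), Helfgott 2013 (`K ≤ 4`) — the constants here are
those of the ELEMENTARY method with kernel-checked inputs, not a record in print.
-/

namespace Literature.NumberTheory.Sieve.ShnirelmanGoldbachExplicit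

open Finset Real
open scoped Classical Pointwise
open Literature.NumberTheory.Sieve Literature.Combinatorics.Additive
open Literature.NumberTheory.Sieve.GoldbachSieveEight (ft Qsum sum_ft_le_Qsum)
open Literature.NumberTheory.Sieve.TwoResidueSelbergExplicit (kappaSet2 TlowK2 sum_ft_ge_kappa2 Qsum_ge_kappa2)
open Literature.NumberTheory.Sieve.GoldbachLinnik (oddSingularFactor oddSingularFactor_nonneg)
open Literature.NumberTheory.Sieve.RomanoffExplicit (PrimeCountingLowerMul primeCountingLowerMul_09212
  primeCounting_ge_div45)

/-! ### Private copies (verbatim) of the helpers of §1–§21 and of the pub ROUND-37 file used below -/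

/-- The halving map: `#{even N ∈ (0, 2y] : N = p + q} ≤ #{b ∈ (0, y] : b ∈ B}`, `B = {0, 1} ∪ {m : 2m = p + q}`
(`N ↦ N/2`). [folklore] -/
private theorem even_goldbach_card_le_half (y : ℕ) :
    #{N ∈ Ioc 0 (2 * y) | Even N ∧ ∃ p q : ℕ, p.Prime ∧ q.Prime ∧ p + q = N}
      ≤ #{b ∈ Ioc 0 y | b ∈ (({0, 1} : Set ℕ) ∪ {m | ∃ p q : ℕ, p.Prime ∧ q.Prime ∧ p + q = 2 * m})} := by
  refine card_le_card_of_injOn (fun N => N / 2) ?_ ?_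
  · intro N hN
    rw [mem_coe, mem_filter, mem_Ioc] at hN
    obtain ⟨⟨hN0, hNy⟩, ⟨k, hk⟩, p, q, hp, hq, hpq⟩ := hN
    rw [mem_coe, mem_filter, mem_Ioc]
    dsimp only
    exact ⟨⟨by omega, by omega⟩, Or.inr ⟨p, q, hp, hq, by omega⟩⟩
  · intro N hN N' hN' h
    rw [mem_coe, mem_filter] at hN hN'
    obtain ⟨k, hk⟩ := hN.2.1
    obtain ⟨k', hk'⟩ := hN'.2.1
    simp only at h
    omega

/-- `σ(S) ≥ 1/K` from `S(N) ≥ N/K` (`N ≥ 1`), for any set `S`. [folklore] -/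
private theorem schnirelmannDensity_ge_of_count' {S : Set ℕ} [DecidablePred (· ∈ S)] {K : ℕ}
    (h : ∀ N : ℕ, 1 ≤ N → (N : ℝ) / K ≤ #{a ∈ Ioc 0 N | a ∈ S}) :
    (1 : ℝ) / K ≤ schnirelmannDensity S := by
  rw [le_schnirelmannDensity_iff]
  intro n hn
  have hn' : (0 : ℝ) < n := by exact_mod_cast hn
  rw [le_div_iff₀ hn']
  have := h n hn
  calc (1 : ℝ) / K * n = (n : ℝ) / K := by ring
    _ ≤ _ := by convert this using 2

/-- `f(n) ≥ 1`. [folklore] -/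
private theorem one_le_oddSingularFactor' (n : ℕ) : 1 ≤ oddSingularFactor n := by
  unfold oddSingularFactor
  have h : ∏ _p ∈ n.primeFactors.filter (2 < ·), (1 : ℝ)
      ≤ ∏ p ∈ n.primeFactors.filter (2 < ·), (((p : ℝ) - 1) / ((p : ℝ) - 2)) := by
    refine Finset.prod_le_prod (fun _ _ => zero_le_one) fun p hp => ?_
    rw [Finset.mem_filter] at hp
    have hp3 : (3 : ℝ) ≤ p := by exact_mod_cast hp.2
    rw [le_div_iff₀ (by linarith)]
    linarith
  simpa using h

/-- `2⁵⁹ ≤ e⁴¹`. [folklore] -/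
private theorem two_pow_59_le_exp_41 : (2 : ℝ) ^ 59 ≤ Real.exp 41 := by
  have he : (2.718281828 : ℝ) ≤ Real.exp 1 := by have := Real.exp_one_gt_d9; linarith
  have h := pow_le_pow_left₀ (by norm_num) he 41
  rw [← Real.exp_nat_mul] at h
  norm_num at h
  exact le_trans (by norm_num) h

/-- `((2y − 3 : ℕ) : ℝ) = 2y − 3` for `y ≥ 2`. [folklore] -/
private theorem cast_two_mul_sub_three {y : ℕ} (hy : 2 ≤ y) : ((2 * y - 3 : ℕ) : ℝ) = 2 * (y : ℝ) - 3 := by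
  have h3y : 3 ≤ 2 * y := by omega
  rw [Nat.cast_sub h3y]
  push_cast
  ring

/-- `log n ≤ 14` for `n < 10⁶` (`10⁶ ≤ 2.7¹⁴ ≤ e¹⁴`). [folklore] -/
private theorem log_le_14_of_lt {n : ℕ} (hn0 : 0 < n) (h6 : n < 10 ^ 6) : Real.log (n : ℝ) ≤ 14 := by
  have hn0' : (0 : ℝ) < n := by exact_mod_cast hn0
  have hy6 : (n : ℝ) ≤ (2.7 : ℝ) ^ 14 := by
    have : (n : ℝ) < 10 ^ 6 := by exact_mod_cast h6
    have h27 : (10 : ℝ) ^ 6 ≤ (2.7 : ℝ) ^ 14 := by norm_num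
    linarith
  have he : (2.7 : ℝ) ≤ Real.exp 1 := by have := Real.exp_one_gt_d9; linarith
  have h14 : (2.7 : ℝ) ^ 14 ≤ Real.exp 14 := by
    rw [show (14 : ℝ) = ((14 : ℕ) : ℝ) * 1 by norm_num, Real.exp_nat_mul]
    exact pow_le_pow_left₀ (by norm_num) he 14
  have := Real.log_le_log hn0' (hy6.trans h14)
  rwa [Real.log_exp] at this

/-- `((2y − q : ℕ) : ℝ) = 2y − q` for `q ≤ 2y`. [folklore] -/
private theorem cast_two_mul_sub {y q : ℕ} (h : q ≤ 2 * y) : ((2 * y - q : ℕ) : ℝ) = 2 * (y : ℝ) - q := by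
  rw [Nat.cast_sub h]
  push_cast
  ring

/-- `f(2) = 1`. [folklore] -/
private theorem oddSingularFactor_two' : oddSingularFactor 2 = 1 := by
  rw [show (2 : ℕ) = 2 ^ 1 * 1 by norm_num, GoldbachLinnik.oddSingularFactor_two_pow_mul 1 one_ne_zero,
    GoldbachLinnik.oddSingularFactor_one]

/-- `f(4) = 1`. [folklore] -/
private theorem oddSingularFactor_four : oddSingularFactor 4 = 1 := by
  rw [show (4 : ℕ) = 2 ^ 2 * 1 by norm_num, GoldbachLinnik.oddSingularFactor_two_pow_mul 2 one_ne_zero,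
    GoldbachLinnik.oddSingularFactor_one]

/-- `f(8) = 1`. [folklore] -/
private theorem oddSingularFactor_eight : oddSingularFactor 8 = 1 := by
  rw [show (8 : ℕ) = 2 ^ 3 * 1 by norm_num, GoldbachLinnik.oddSingularFactor_two_pow_mul 3 one_ne_zero,
    GoldbachLinnik.oddSingularFactor_one]

/-- `f(6) = 2` (the factor `(3−1)/(3−2)`). [folklore] -/
private theorem oddSingularFactor_six : oddSingularFactor 6 = 2 := by
  rw [show (6 : ℕ) = 2 ^ 1 * 3 by norm_num, GoldbachLinnik.oddSingularFactor_two_pow_mul 1 (by norm_num)]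
  show ∏ p ∈ (Nat.primeFactors 3).filter (2 < ·), (((p : ℝ) - 1) / ((p : ℝ) - 2)) = 2
  rw [Nat.prime_three.primeFactors, Finset.filter_singleton, if_pos (by norm_num), Finset.prod_singleton]
  norm_num

/-- `2^59 ≤ e^41` as a numeral. [folklore] -/
private theorem numeral_le_exp_41 : (576460752303423488 : ℝ) ≤ Real.exp 41 := by
  have := two_pow_59_le_exp_41
  norm_num at this
  exact this

/-- `f(10) = 4/3`. [folklore] -/
private theorem oddSingularFactor_ten : oddSingularFactor 10 = 4 / 3 := by
  rw [show (10 : ℕ) = 2 ^ 1 * 5 by norm_num, GoldbachLinnik.oddSingularFactor_two_pow_mul 1 (by norm_num)]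
  show ∏ p ∈ (Nat.primeFactors 5).filter (2 < ·), (((p : ℝ) - 1) / ((p : ℝ) - 2)) = 4 / 3
  rw [Nat.prime_five.primeFactors, Finset.filter_singleton, if_pos (by norm_num), Finset.prod_singleton]
  norm_num

/-- `f(12) = 2`. [folklore] -/
private theorem oddSingularFactor_twelve : oddSingularFactor 12 = 2 := by
  rw [show (12 : ℕ) = 2 ^ 2 * 3 by norm_num, GoldbachLinnik.oddSingularFactor_two_pow_mul 2 (by norm_num)]
  show ∏ p ∈ (Nat.primeFactors 3).filter (2 < ·), (((p : ℝ) - 1) / ((p : ℝ) - 2)) = 2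
  rw [Nat.prime_three.primeFactors, Finset.filter_singleton, if_pos (by norm_num), Finset.prod_singleton]
  norm_num

/-- `f(14) = 6/5`. [folklore] -/
private theorem oddSingularFactor_fourteen : oddSingularFactor 14 = 6 / 5 := by
  rw [show (14 : ℕ) = 2 ^ 1 * 7 by norm_num, GoldbachLinnik.oddSingularFactor_two_pow_mul 1 (by norm_num)]
  show ∏ p ∈ (Nat.primeFactors 7).filter (2 < ·), (((p : ℝ) - 1) / ((p : ℝ) - 2)) = 6 / 5
  rw [(by norm_num : Nat.Prime 7).primeFactors, Finset.filter_singleton, if_pos (by norm_num), Finset.prod_singleton]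
  norm_num

/-- `f(16) = 1`. [folklore] -/
private theorem oddSingularFactor_sixteen : oddSingularFactor 16 = 1 := by
  rw [show (16 : ℕ) = 2 ^ 4 * 1 by norm_num, GoldbachLinnik.oddSingularFactor_two_pow_mul 4 one_ne_zero,
    GoldbachLinnik.oddSingularFactor_one]

/-- `f(18) = 2`. [folklore] -/
private theorem oddSingularFactor_eighteen : oddSingularFactor 18 = 2 := by
  rw [show (18 : ℕ) = 2 ^ 1 * 9 by norm_num, GoldbachLinnik.oddSingularFactor_two_pow_mul 1 (by norm_num)]
  show ∏ p ∈ (Nat.primeFactors 9).filter (2 < ·), (((p : ℝ) - 1) / ((p : ℝ) - 2)) = 2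
  rw [show (9 : ℕ) = 3 ^ 2 by norm_num, Nat.primeFactors_prime_pow (by norm_num) Nat.prime_three,
    Finset.filter_singleton, if_pos (by norm_num), Finset.prod_singleton]
  norm_num

/-- `f(20) = 4 / 3`. [folklore] -/
private theorem oddSingularFactor_twenty : oddSingularFactor 20 = 4 / 3 := by
  rw [show (20 : ℕ) = 2 ^ 2 * 5 by norm_num, GoldbachLinnik.oddSingularFactor_two_pow_mul 2 (by norm_num)]
  show ∏ p ∈ (Nat.primeFactors 5).filter (2 < ·), (((p : ℝ) - 1) / ((p : ℝ) - 2)) = 4 / 3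
  rw [Nat.prime_five.primeFactors, Finset.filter_singleton, if_pos (by norm_num), Finset.prod_singleton]
  norm_num

/-- `f(22) = 10 / 9`. [folklore] -/
private theorem oddSingularFactor_twentytwo : oddSingularFactor 22 = 10 / 9 := by
  rw [show (22 : ℕ) = 2 ^ 1 * 11 by norm_num, GoldbachLinnik.oddSingularFactor_two_pow_mul 1 (by norm_num)]
  show ∏ p ∈ (Nat.primeFactors 11).filter (2 < ·), (((p : ℝ) - 1) / ((p : ℝ) - 2)) = 10 / 9
  rw [(by norm_num : Nat.Prime 11).primeFactors, Finset.filter_singleton, if_pos (by norm_num), Finset.prod_singleton]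
  norm_num

/-- `f(24) = 2`. [folklore] -/
private theorem oddSingularFactor_twentyfour : oddSingularFactor 24 = 2 := by
  rw [show (24 : ℕ) = 2 ^ 3 * 3 by norm_num, GoldbachLinnik.oddSingularFactor_two_pow_mul 3 (by norm_num)]
  show ∏ p ∈ (Nat.primeFactors 3).filter (2 < ·), (((p : ℝ) - 1) / ((p : ℝ) - 2)) = 2
  rw [Nat.prime_three.primeFactors, Finset.filter_singleton, if_pos (by norm_num), Finset.prod_singleton]
  norm_num

/-- `f(26) = 12 / 11`. [folklore] -/
private theorem oddSingularFactor_twentysix : oddSingularFactor 26 = 12 / 11 := by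
  rw [show (26 : ℕ) = 2 ^ 1 * 13 by norm_num, GoldbachLinnik.oddSingularFactor_two_pow_mul 1 (by norm_num)]
  show ∏ p ∈ (Nat.primeFactors 13).filter (2 < ·), (((p : ℝ) - 1) / ((p : ℝ) - 2)) = 12 / 11
  rw [(by norm_num : Nat.Prime 13).primeFactors, Finset.filter_singleton, if_pos (by norm_num), Finset.prod_singleton]
  norm_num

/-- `f(28) = 6 / 5`. [folklore] -/
private theorem oddSingularFactor_twentyeight : oddSingularFactor 28 = 6 / 5 := by
  rw [show (28 : ℕ) = 2 ^ 2 * 7 by norm_num, GoldbachLinnik.oddSingularFactor_two_pow_mul 2 (by norm_num)]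
  show ∏ p ∈ (Nat.primeFactors 7).filter (2 < ·), (((p : ℝ) - 1) / ((p : ℝ) - 2)) = 6 / 5
  rw [(by norm_num : Nat.Prime 7).primeFactors, Finset.filter_singleton, if_pos (by norm_num), Finset.prod_singleton]
  norm_num

/-- `f(30) = 8 / 3`. [folklore] -/
private theorem oddSingularFactor_thirty : oddSingularFactor 30 = 8 / 3 := by
  rw [show (30 : ℕ) = 2 ^ 1 * 15 by norm_num, GoldbachLinnik.oddSingularFactor_two_pow_mul 1 (by norm_num)]
  show ∏ p ∈ (Nat.primeFactors 15).filter (2 < ·), (((p : ℝ) - 1) / ((p : ℝ) - 2)) = 8 / 3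
  rw [show (15 : ℕ) = 3 * 5 by norm_num, Nat.primeFactors_mul (by norm_num) (by norm_num),
    Nat.prime_three.primeFactors, Nat.prime_five.primeFactors, Finset.filter_union, Finset.filter_singleton,
    Finset.filter_singleton, if_pos (by norm_num), if_pos (by norm_num), Finset.prod_union (by simp),
    Finset.prod_singleton, Finset.prod_singleton]
  norm_num

/-- `f(32) = 1`. [folklore] -/
private theorem oddSingularFactor_thirtytwo : oddSingularFactor 32 = 1 := by
  rw [show (32 : ℕ) = 2 ^ 5 * 1 by norm_num, GoldbachLinnik.oddSingularFactor_two_pow_mul 5 one_ne_zero,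
    GoldbachLinnik.oddSingularFactor_one]

/-- `f(34) = 16 / 15`. [folklore] -/
private theorem oddSingularFactor_thirtyfour : oddSingularFactor 34 = 16 / 15 := by
  rw [show (34 : ℕ) = 2 ^ 1 * 17 by norm_num, GoldbachLinnik.oddSingularFactor_two_pow_mul 1 (by norm_num)]
  show ∏ p ∈ (Nat.primeFactors 17).filter (2 < ·), (((p : ℝ) - 1) / ((p : ℝ) - 2)) = 16 / 15
  rw [(by norm_num : Nat.Prime 17).primeFactors, Finset.filter_singleton, if_pos (by norm_num), Finset.prod_singleton]
  norm_num

/-- `f(36) = 2`. [folklore] -/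
private theorem oddSingularFactor_thirtysix : oddSingularFactor 36 = 2 := by
  rw [show (36 : ℕ) = 2 ^ 2 * 9 by norm_num, GoldbachLinnik.oddSingularFactor_two_pow_mul 2 (by norm_num)]
  show ∏ p ∈ (Nat.primeFactors 9).filter (2 < ·), (((p : ℝ) - 1) / ((p : ℝ) - 2)) = 2
  rw [show (9 : ℕ) = 3 ^ 2 by norm_num, Nat.primeFactors_prime_pow (by norm_num) Nat.prime_three,
    Finset.filter_singleton, if_pos (by norm_num), Finset.prod_singleton]
  norm_num

/-- `f(38) = 18 / 17`. [folklore] -/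
private theorem oddSingularFactor_thirtyeight : oddSingularFactor 38 = 18 / 17 := by
  rw [show (38 : ℕ) = 2 ^ 1 * 19 by norm_num, GoldbachLinnik.oddSingularFactor_two_pow_mul 1 (by norm_num)]
  show ∏ p ∈ (Nat.primeFactors 19).filter (2 < ·), (((p : ℝ) - 1) / ((p : ℝ) - 2)) = 18 / 17
  rw [(by norm_num : Nat.Prime 19).primeFactors, Finset.filter_singleton, if_pos (by norm_num), Finset.prod_singleton]
  norm_num

/-- `TlowK` is increasing on `[2, ∞)` (copy of the tree's private lemma). [folklore] -/
private theorem TlowK_mono' {l₁ l : ℝ} (h₁ : 2 ≤ l₁) (h : l₁ ≤ l) :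
    TwoResidueSelbergExplicit.TlowK l₁ ≤ TwoResidueSelbergExplicit.TlowK l := by
  unfold TwoResidueSelbergExplicit.TlowK; nlinarith [h₁, h]

/-- `TlowK(l₁) ≥ 100` for `l₁ ≥ 19.11` (copy of the tree's private lemma). [folklore] -/
private theorem TlowK_ge' {l₁ : ℝ} (h₁ : 19.11 ≤ l₁) : 100 ≤ TwoResidueSelbergExplicit.TlowK l₁ := by
  unfold TwoResidueSelbergExplicit.TlowK; nlinarith [h₁]

/-- The boundary numerics from `L ≥ 41`: `(E/4 + 1)·L² ≤ 0.01·E²` once `100 L² ≤ E` (copy of the tree's private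
lemma). [folklore] -/
private theorem tail_numeric'' {L E : ℝ} (hL : 41 ≤ L) (hEL : 100 * L ^ 2 ≤ E) :
    (E / 4 + 1) * L ^ 2 ≤ 0.01 * E ^ 2 := by
  have hL2 : (1681 : ℝ) ≤ L ^ 2 := by nlinarith [hL]
  have hE : (168100 : ℝ) ≤ E := by linarith
  nlinarith [hEL, hE, hL2]

/-- `e^{2.0796} ≥ 8.00096 = 8·1.00012` (`2.0796 = 3·0.6931471808 + 0.0001584576`). [folklore] -/
private theorem exp_20796_ge : (8.00096 : ℝ) ≤ Real.exp 2.0796 := by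
  have hl2 : (2 : ℝ) ≤ Real.exp 0.6931471808 := by
    have h1 := Real.exp_log (show (0:ℝ) < 2 by norm_num)
    have h2 := Real.exp_le_exp.mpr Real.log_two_lt_d9.le
    linarith
  have hsmall : (1.0001584576 : ℝ) ≤ Real.exp 0.0001584576 := by
    have := Real.add_one_le_exp (0.0001584576 : ℝ); linarith
  have hprod : Real.exp (2.0796 : ℝ) = Real.exp 0.6931471808 ^ 3 * Real.exp 0.0001584576 := by
    rw [← Real.exp_nat_mul, ← Real.exp_add]; norm_num
  rw [hprod]
  have h8 : (8 : ℝ) ≤ Real.exp 0.6931471808 ^ 3 := by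
    have := pow_le_pow_left₀ (by norm_num : (0:ℝ) ≤ 2) hl2 3
    linarith [show ((2 : ℝ)) ^ 3 = 8 by norm_num]
  nlinarith [mul_le_mul h8 hsmall (by norm_num) (by positivity)]

/-- `e^{2.7728} ≥ 16.00192 = 16·1.00012` (`2.7728 = 4·0.6931471808 + 0.0002112768`). [folklore] -/
private theorem exp_27728_ge : (16.00192 : ℝ) ≤ Real.exp 2.7728 := by
  have hl2 : (2 : ℝ) ≤ Real.exp 0.6931471808 := by
    have h1 := Real.exp_log (show (0:ℝ) < 2 by norm_num)
    have h2 := Real.exp_le_exp.mpr Real.log_two_lt_d9.le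
    linarith
  have hsmall : (1.0002112768 : ℝ) ≤ Real.exp 0.0002112768 := by
    have := Real.add_one_le_exp (0.0002112768 : ℝ); linarith
  have hprod : Real.exp (2.7728 : ℝ) = Real.exp 0.6931471808 ^ 4 * Real.exp 0.0002112768 := by
    rw [← Real.exp_nat_mul, ← Real.exp_add]; norm_num
  rw [hprod]
  have h16 : (16 : ℝ) ≤ Real.exp 0.6931471808 ^ 4 := by
    have := pow_le_pow_left₀ (by norm_num : (0:ℝ) ≤ 2) hl2 4
    linarith [show ((2 : ℝ)) ^ 4 = 16 by norm_num]
  nlinarith [mul_le_mul h16 hsmall (by norm_num) (by positivity)]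

set_option maxHeartbeats 1600000 in

/-- **THE κ-REFINED EXPLICIT LARGE-SIEVE STEP WITH LENGTH `X = ⌊√N⌋/c`** (`4 ≤ c ≤ 47`, `e^{lc} ≥ 1.00012·c`):
if `Λ ≥ max(41, 38.22 + 2·lc)`, `(c² + 1) L² ≤ c²(A − 0.02)·TlowK(L/2 − lc)` for all `L ≥ Λ`, and a count `C` satisfies
the Bateman–Diamond inequality `C·Q_∅(X) ≤ (X² + N − 1)·F + B·Q_∅(X)` at `X = ⌊√N⌋/c` with `F ≥ 1`, `B ≤ 2X + 2`, then
`C ≤ A·F·N/log²N` for every `N ≥ e^Λ`.  (The tree's `explicit_of_largeSieve_kappa` is `c = 4`, `lc = 1.38632`, where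
`(c² + 1)/c² = 17/16`; a larger `c` trades the factor `17/16` for `log c` inside `TlowK`, which is second order once
`L ≳ 100`: at `L = 360`, `c = 16` gives `A = 13.08` against `13.66`.)
[cite: BatemanDiamond2004, Thm 13.8, §13.4–13.5 pp. 325–328 (explicit form proved here)] -/
private theorem explicit_of_largeSieve_kappa_c {c : ℕ} {lc Λ A : ℝ} (hc4 : 4 ≤ c) (hc47 : c ≤ 47)
    (hlc : (c : ℝ) * 1.00012 ≤ Real.exp lc) (hΛ : 41 ≤ Λ) (hΛc : 38.22 + 2 * lc ≤ Λ)
    (hA : ∀ L : ℝ, Λ ≤ L → ((c : ℝ) ^ 2 + 1) * L ^ 2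
        ≤ (c : ℝ) ^ 2 * (A - 0.02) * TwoResidueSelbergExplicit.TlowK (L / 2 - lc))
    {N : ℕ} {C F B : ℝ} (hN : Real.exp Λ ≤ (N : ℝ)) (hF1 : 1 ≤ F)
    (hB : B ≤ 2 * ((Nat.sqrt N / c : ℕ) : ℝ) + 2)
    (hBD : C * GoldbachSieveEight.Qsum ∅ (Nat.sqrt N / c) ≤ (((Nat.sqrt N / c : ℕ) : ℝ) ^ 2 + N - 1) * F
      + B * GoldbachSieveEight.Qsum ∅ (Nat.sqrt N / c)) :
    C ≤ A * F * (N : ℝ) / Real.log (N : ℝ) ^ 2 := by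
  have hN0 : (0 : ℝ) < N := lt_of_lt_of_le (Real.exp_pos Λ) hN
  set L := Real.log (N : ℝ) with hLdef
  have hL : Λ ≤ L := by
    have := Real.log_le_log (Real.exp_pos Λ) hN
    rwa [Real.log_exp] at this
  have hL41 : (41 : ℝ) ≤ L := le_trans hΛ hL
  have hL2pos : 0 < L ^ 2 := by positivity
  have hcpos : 0 < c := by omega
  have hc0 : (0 : ℝ) < c := by exact_mod_cast hcpos
  have hcR4 : (4 : ℝ) ≤ c := by exact_mod_cast hc4
  have hcR47 : (c : ℝ) ≤ 47 := by exact_mod_cast hc47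
  -- E = √N = exp(L/2)
  set E := Real.exp (L / 2) with hEdef
  have hE0 : 0 < E := Real.exp_pos _
  have hE2 : E ^ 2 = N := by
    have : E ^ 2 = Real.exp L := by rw [hEdef, sq, ← Real.exp_add]; ring_nf
    rw [this, hLdef, Real.exp_log hN0]
  have hE8 : (L / 2) ^ 8 / 40320 ≤ E := by
    have := Real.pow_div_factorial_le_exp (L / 2) (by linarith) 8
    simpa [Nat.factorial] using this
  have hLsq : (1681 : ℝ) ≤ L ^ 2 := by nlinarith [hL41]
  have hL4 : (1681 : ℝ) ^ 2 ≤ (L ^ 2) ^ 2 := pow_le_pow_left₀ (by norm_num) hLsq 2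
  have hEL : 100 * L ^ 2 ≤ E := by
    have h1 : (1681 : ℝ) ^ 2 * 1681 * L ^ 2 ≤ (L ^ 2) ^ 2 * L ^ 2 * L ^ 2 := by
      have := mul_le_mul hL4 hLsq (by norm_num) (by positivity)
      nlinarith [this, hL2pos]
    have h2 : (L / 2) ^ 8 / 40320 = (L ^ 2) ^ 2 * L ^ 2 * L ^ 2 / 10321920 := by ring
    rw [h2] at hE8
    nlinarith [h1, hE8]
  have hEbig2 : (773000 : ℝ) ≤ E := by
    have h1 : ((20.5 : ℝ)) ^ 8 ≤ (L / 2) ^ 8 := pow_le_pow_left₀ (by norm_num) (by linarith) 8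
    have h2 : ((20.5 : ℝ)) ^ 8 / 40320 ≤ E := le_trans (div_le_div_of_nonneg_right h1 (by norm_num)) hE8
    norm_num at h2
    linarith
  -- s = ⌊√N⌋, X = s / c
  set s := Nat.sqrt N with hsdef
  set X := s / c with hXdef
  have hs2 : (s : ℝ) ^ 2 ≤ N := by exact_mod_cast Nat.sqrt_le' N
  have hs2' : (N : ℝ) < ((s : ℝ) + 1) ^ 2 := by exact_mod_cast Nat.lt_succ_sqrt' N
  have hsE : (s : ℝ) ≤ E := by
    have : (s : ℝ) ^ 2 ≤ E ^ 2 := by rw [hE2]; exact hs2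
    exact (pow_le_pow_iff_left₀ (Nat.cast_nonneg s) hE0.le two_ne_zero).mp this
  have hEs : E < (s : ℝ) + 1 := by
    have : E ^ 2 < ((s : ℝ) + 1) ^ 2 := by rw [hE2]; exact hs2'
    exact (pow_lt_pow_iff_left₀ hE0.le (by positivity) two_ne_zero).mp this
  have hXc : X * c ≤ s := Nat.div_mul_le_self s c
  have hXc' : s + 1 ≤ X * c + c := Nat.lt_div_mul_add hcpos
  have hXcR : (X : ℝ) * c ≤ s := by exact_mod_cast hXc
  have hXcR' : (s : ℝ) + 1 ≤ (X : ℝ) * c + c := by exact_mod_cast hXc'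
  have hX0R : (0 : ℝ) ≤ X := Nat.cast_nonneg X
  have hXR : (X : ℝ) ^ 2 * (c : ℝ) ^ 2 ≤ (N : ℝ) := by
    have : ((X : ℝ) * c) ^ 2 ≤ (s : ℝ) ^ 2 := pow_le_pow_left₀ (by positivity) hXcR 2
    nlinarith [hs2, this]
  have hXlo : E / c - 1 < (X : ℝ) := by
    have h1 : E < (X : ℝ) * c + c := by linarith [hEs, hXcR']
    rw [sub_lt_iff_lt_add, div_lt_iff₀ hc0]; linarith
  have hXhi : (X : ℝ) ≤ E / c := by
    rw [le_div_iff₀ hc0]; linarith [hsE, hXcR]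
  have hEc : (16385 : ℝ) ≤ E / c := by
    rw [le_div_iff₀ hc0]; nlinarith [hEbig2, hcR47]
  have hX0 : (0 : ℝ) < X := by linarith
  have hX16384 : 16384 ≤ X := by
    have : (16384 : ℝ) ≤ X := by linarith
    exact_mod_cast this
  -- log X ≥ l₁ := L/2 − lc
  set l₁ := L / 2 - lc with hl₁def
  have hexp : Real.exp l₁ ≤ (X : ℝ) := by
    rw [hl₁def, Real.exp_sub]
    have hlc0 : (0 : ℝ) < (c : ℝ) * 1.00012 := by positivity
    have h1 : E / Real.exp lc ≤ E / ((c : ℝ) * 1.00012) :=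
      div_le_div_of_nonneg_left hE0.le hlc0 hlc
    have h2 : E / ((c : ℝ) * 1.00012) ≤ E / c - 1 := by
      rw [show E / ((c : ℝ) * 1.00012) = E / c / 1.00012 by rw [div_div],
        div_le_iff₀ (by norm_num : (0 : ℝ) < 1.00012)]
      linarith [hEc]
    linarith [hXlo]
  have hl : l₁ ≤ Real.log X := by
    rw [Real.le_log_iff_exp_le hX0]; exact hexp
  have hl₁ : (19.11 : ℝ) ≤ l₁ := by rw [hl₁def]; linarith
  -- Q ≥ TlowK(log X) ≥ TlowK(l₁) ≥ 100
  set Q := GoldbachSieveEight.Qsum ∅ X with hQdef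
  have hQ : TwoResidueSelbergExplicit.TlowK (Real.log X) ≤ Q := TwoResidueSelbergExplicit.Qsum_ge_kappa hX16384
  have hQT : TwoResidueSelbergExplicit.TlowK l₁ ≤ Q := le_trans (TlowK_mono' (by linarith) hl) hQ
  have hT₁ : (100 : ℝ) ≤ TwoResidueSelbergExplicit.TlowK l₁ := TlowK_ge' hl₁
  have hQpos : 0 < Q := by linarith
  have hF0 : 0 ≤ F := le_trans zero_le_one hF1
  have hC1 : C ≤ ((X : ℝ) ^ 2 + N - 1) * F / Q + B := by
    have : C * Q ≤ (((X : ℝ) ^ 2 + N - 1) * F / Q + B) * Q := by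
      rw [add_mul, div_mul_cancel₀ _ hQpos.ne']
      exact hBD
    exact le_of_mul_le_mul_right this hQpos
  have hc2pos : (0 : ℝ) < (c : ℝ) ^ 2 := by positivity
  set K : ℝ := ((c : ℝ) ^ 2 + 1) / (c : ℝ) ^ 2 with hKdef
  have hK0 : 0 < K := by positivity
  have hC2 : ((X : ℝ) ^ 2 + N - 1) * F / Q ≤ K * (N : ℝ) * F / TwoResidueSelbergExplicit.TlowK l₁ := by
    have hnum0 : 0 ≤ K * (N : ℝ) * F := by positivity
    have hXN : (X : ℝ) ^ 2 ≤ (N : ℝ) / (c : ℝ) ^ 2 := by rw [le_div_iff₀ hc2pos]; exact hXR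
    have hKN : (X : ℝ) ^ 2 + N - 1 ≤ K * N := by
      have : K * N = N / (c : ℝ) ^ 2 + N := by rw [hKdef]; field_simp; ring
      rw [this]; linarith
    have hnum : ((X : ℝ) ^ 2 + N - 1) * F ≤ K * (N : ℝ) * F := mul_le_mul_of_nonneg_right hKN hF0
    calc ((X : ℝ) ^ 2 + N - 1) * F / Q ≤ K * (N : ℝ) * F / Q := div_le_div_of_nonneg_right hnum hQpos.le
      _ ≤ K * (N : ℝ) * F / TwoResidueSelbergExplicit.TlowK l₁ :=
          div_le_div_of_nonneg_left hnum0 (by linarith) hQT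
  -- main term
  have hmain : K * (N : ℝ) * F / TwoResidueSelbergExplicit.TlowK l₁ ≤ (A - 0.02) * F * (N : ℝ) / L ^ 2 := by
    have hkey : ((c : ℝ) ^ 2 + 1) * L ^ 2 ≤ (c : ℝ) ^ 2 * (A - 0.02) * TwoResidueSelbergExplicit.TlowK l₁ := hA L hL
    have hkey' : K * L ^ 2 ≤ (A - 0.02) * TwoResidueSelbergExplicit.TlowK l₁ := by
      rw [hKdef, div_mul_eq_mul_div, div_le_iff₀ hc2pos]
      linarith [hkey]
    rw [div_le_div_iff₀ (by linarith) hL2pos]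
    have hNF : 0 ≤ (N : ℝ) * F := by positivity
    have h := mul_le_mul_of_nonneg_left hkey' hNF
    calc K * (N : ℝ) * F * L ^ 2 = (N : ℝ) * F * (K * L ^ 2) := by ring
      _ ≤ (N : ℝ) * F * ((A - 0.02) * TwoResidueSelbergExplicit.TlowK l₁) := h
      _ = (A - 0.02) * F * (N : ℝ) * TwoResidueSelbergExplicit.TlowK l₁ := by ring
  -- boundary term
  have htail : B ≤ 0.02 * F * (N : ℝ) / L ^ 2 := by
    have h2 : (E / 4 + 1) * L ^ 2 ≤ 0.01 * (N : ℝ) := by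
      rw [← hE2]; exact tail_numeric'' hL41 hEL
    have h3 : 0.02 * (N : ℝ) ≤ 0.02 * F * (N : ℝ) :=
      calc 0.02 * (N : ℝ) ≤ F * (0.02 * (N : ℝ)) := le_mul_of_one_le_left (by positivity) hF1
        _ = 0.02 * F * (N : ℝ) := by ring
    rw [le_div_iff₀ hL2pos]
    have h1 : B * L ^ 2 ≤ 2 * ((E / 4 + 1) * L ^ 2) := by
      have hEc4 : E / c ≤ E / 4 := div_le_div_of_nonneg_left hE0.le (by norm_num) hcR4
      have : B ≤ 2 * (E / 4 + 1) := by linarith only [hB, hXhi, hEc4]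
      nlinarith only [this, hL2pos]
    linarith only [h1, h2, h3]
  calc C ≤ ((X : ℝ) ^ 2 + N - 1) * F / Q + B := hC1
    _ ≤ K * (N : ℝ) * F / TwoResidueSelbergExplicit.TlowK l₁ + B := by linarith only [hC2]
    _ ≤ (A - 0.02) * F * (N : ℝ) / L ^ 2 + 0.02 * F * (N : ℝ) / L ^ 2 := add_le_add hmain htail
    _ = A * F * (N : ℝ) / L ^ 2 := by ring

/-! ## §22 ROUND-38 «CELLS»: the sieve of ROUND-37 read through the enlarged cell polynomial `TlowK2` -/

/-! ### §22.1 The explicit large-sieve step with `TlowK2` -/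

/-- `TlowK2` is increasing on `[2, ∞)`. [folklore] -/
private theorem TlowK2_mono {l₁ l : ℝ} (h₁ : 2 ≤ l₁) (h : l₁ ≤ l) : TlowK2 l₁ ≤ TlowK2 l := by
  unfold TlowK2; nlinarith [h₁, h, mul_nonneg (sub_nonneg.2 h) (sub_nonneg.2 h₁), sq_nonneg (l - l₁)]

/-- `TlowK2(l₁) ≥ 100` for `l₁ ≥ 19.11`. [folklore] -/
private theorem TlowK2_ge {l₁ : ℝ} (h₁ : 19.11 ≤ l₁) : 100 ≤ TlowK2 l₁ := by
  unfold TlowK2; nlinarith [h₁, sq_nonneg (l₁ - 19.11)]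

/-- `e^{1.3865} ≥ 4.00048 = 4·1.00012` (`1.3865 = 2·0.6931471808 + 0.0002056384`). [folklore] -/
private theorem exp_13865_ge : (4.00048 : ℝ) ≤ Real.exp 1.3865 := by
  have hl2 : (2 : ℝ) ≤ Real.exp 0.6931471808 := by
    have h1 := Real.exp_log (show (0:ℝ) < 2 by norm_num)
    have h2 := Real.exp_le_exp.mpr Real.log_two_lt_d9.le
    linarith
  have hsmall : (1.0002056384 : ℝ) ≤ Real.exp 0.0002056384 := by
    have := Real.add_one_le_exp (0.0002056384 : ℝ); linarith
  have hprod : Real.exp (1.3865 : ℝ) = Real.exp 0.6931471808 ^ 2 * Real.exp 0.0002056384 := by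
    rw [← Real.exp_nat_mul, ← Real.exp_add]; norm_num
  rw [hprod]
  have h4 : (4 : ℝ) ≤ Real.exp 0.6931471808 ^ 2 := by
    have := pow_le_pow_left₀ (by norm_num : (0:ℝ) ≤ 2) hl2 2
    linarith [show ((2 : ℝ)) ^ 2 = 4 by norm_num]
  nlinarith [mul_le_mul h4 hsmall (by norm_num) (by positivity)]

set_option maxHeartbeats 1600000 in
/-- **THE ENLARGED-CELL EXPLICIT LARGE-SIEVE STEP WITH LENGTH `X = ⌊√N⌋/c`** (ROUND-38; `4 ≤ c ≤ 40`, `e^{lc} ≥ 1.00012·c`):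
if `Λ ≥ max(41, 38.22 + 2·lc)`, `(c² + 1) L² ≤ c²(A − 0.02)·TlowK2(L/2 − lc)` for all `L ≥ Λ`, and a count `C` satisfies
the Bateman–Diamond inequality `C·Q_∅(X) ≤ (X² + N − 1)·F + B·Q_∅(X)` at `X = ⌊√N⌋/c` with `F ≥ 1`, `B ≤ 2X + 2`, then
`C ≤ A·F·N/log²N` for every `N ≥ e^Λ` (as ROUND-37's `explicit_of_largeSieve_kappa_c`, with the main term read
through `Qsum_ge_kappa2`, i.e. `X ≥ 2^18`, guaranteed by `√N ≥ (L/2)^12/12! ≥ 1.15·10^7` at `L ≥ 41` and `c ≤ 40`).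
[cite: BatemanDiamond2004, Thm 13.8, §13.4–13.5 pp. 325–328 (explicit form proved here)] -/
theorem explicit_of_largeSieve_kappa2_c {c : ℕ} {lc Λ A : ℝ} (hc4 : 4 ≤ c) (hc40 : c ≤ 40)
    (hlc : (c : ℝ) * 1.00012 ≤ Real.exp lc) (hΛ : 41 ≤ Λ) (hΛc : 38.22 + 2 * lc ≤ Λ)
    (hA : ∀ L : ℝ, Λ ≤ L → ((c : ℝ) ^ 2 + 1) * L ^ 2
        ≤ (c : ℝ) ^ 2 * (A - 0.02) * TlowK2 (L / 2 - lc))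
    {N : ℕ} {C F B : ℝ} (hN : Real.exp Λ ≤ (N : ℝ)) (hF1 : 1 ≤ F)
    (hB : B ≤ 2 * ((Nat.sqrt N / c : ℕ) : ℝ) + 2)
    (hBD : C * GoldbachSieveEight.Qsum ∅ (Nat.sqrt N / c) ≤ (((Nat.sqrt N / c : ℕ) : ℝ) ^ 2 + N - 1) * F
      + B * GoldbachSieveEight.Qsum ∅ (Nat.sqrt N / c)) :
    C ≤ A * F * (N : ℝ) / Real.log (N : ℝ) ^ 2 := by
  have hN0 : (0 : ℝ) < N := lt_of_lt_of_le (Real.exp_pos Λ) hN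
  set L := Real.log (N : ℝ) with hLdef
  have hL : Λ ≤ L := by
    have := Real.log_le_log (Real.exp_pos Λ) hN
    rwa [Real.log_exp] at this
  have hL41 : (41 : ℝ) ≤ L := le_trans hΛ hL
  have hL2pos : 0 < L ^ 2 := by positivity
  have hcpos : 0 < c := by omega
  have hc0 : (0 : ℝ) < c := by exact_mod_cast hcpos
  have hcR4 : (4 : ℝ) ≤ c := by exact_mod_cast hc4
  have hcR40 : (c : ℝ) ≤ 40 := by exact_mod_cast hc40
  -- E = √N = exp(L/2)
  set E := Real.exp (L / 2) with hEdef
  have hE0 : 0 < E := Real.exp_pos _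
  have hE2 : E ^ 2 = N := by
    have : E ^ 2 = Real.exp L := by rw [hEdef, sq, ← Real.exp_add]; ring_nf
    rw [this, hLdef, Real.exp_log hN0]
  have hE8 : (L / 2) ^ 8 / 40320 ≤ E := by
    have := Real.pow_div_factorial_le_exp (L / 2) (by linarith) 8
    simpa [Nat.factorial] using this
  have hLsq : (1681 : ℝ) ≤ L ^ 2 := by nlinarith [hL41]
  have hL4 : (1681 : ℝ) ^ 2 ≤ (L ^ 2) ^ 2 := pow_le_pow_left₀ (by norm_num) hLsq 2
  have hEL : 100 * L ^ 2 ≤ E := by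
    have h1 : (1681 : ℝ) ^ 2 * 1681 * L ^ 2 ≤ (L ^ 2) ^ 2 * L ^ 2 * L ^ 2 := by
      have := mul_le_mul hL4 hLsq (by norm_num) (by positivity)
      nlinarith [this, hL2pos]
    have h2 : (L / 2) ^ 8 / 40320 = (L ^ 2) ^ 2 * L ^ 2 * L ^ 2 / 10321920 := by ring
    rw [h2] at hE8
    nlinarith [h1, hE8]
  have hE12 : (L / 2) ^ 12 / 479001600 ≤ E := by
    have := Real.pow_div_factorial_le_exp (L / 2) (by linarith) 12
    simpa [Nat.factorial] using this
  have hEbig2 : (11500000 : ℝ) ≤ E := by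
    have h1 : ((20.5 : ℝ)) ^ 12 ≤ (L / 2) ^ 12 := pow_le_pow_left₀ (by norm_num) (by linarith) 12
    have h2 : ((20.5 : ℝ)) ^ 12 / 479001600 ≤ E := le_trans (div_le_div_of_nonneg_right h1 (by norm_num)) hE12
    norm_num at h2
    linarith
  -- s = ⌊√N⌋, X = s / c
  set s := Nat.sqrt N with hsdef
  set X := s / c with hXdef
  have hs2 : (s : ℝ) ^ 2 ≤ N := by exact_mod_cast Nat.sqrt_le' N
  have hs2' : (N : ℝ) < ((s : ℝ) + 1) ^ 2 := by exact_mod_cast Nat.lt_succ_sqrt' N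
  have hsE : (s : ℝ) ≤ E := by
    have : (s : ℝ) ^ 2 ≤ E ^ 2 := by rw [hE2]; exact hs2
    exact (pow_le_pow_iff_left₀ (Nat.cast_nonneg s) hE0.le two_ne_zero).mp this
  have hEs : E < (s : ℝ) + 1 := by
    have : E ^ 2 < ((s : ℝ) + 1) ^ 2 := by rw [hE2]; exact hs2'
    exact (pow_lt_pow_iff_left₀ hE0.le (by positivity) two_ne_zero).mp this
  have hXc : X * c ≤ s := Nat.div_mul_le_self s c
  have hXc' : s + 1 ≤ X * c + c := Nat.lt_div_mul_add hcpos
  have hXcR : (X : ℝ) * c ≤ s := by exact_mod_cast hXc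
  have hXcR' : (s : ℝ) + 1 ≤ (X : ℝ) * c + c := by exact_mod_cast hXc'
  have hX0R : (0 : ℝ) ≤ X := Nat.cast_nonneg X
  have hXR : (X : ℝ) ^ 2 * (c : ℝ) ^ 2 ≤ (N : ℝ) := by
    have : ((X : ℝ) * c) ^ 2 ≤ (s : ℝ) ^ 2 := pow_le_pow_left₀ (by positivity) hXcR 2
    nlinarith [hs2, this]
  have hXlo : E / c - 1 < (X : ℝ) := by
    have h1 : E < (X : ℝ) * c + c := by linarith [hEs, hXcR']
    rw [sub_lt_iff_lt_add, div_lt_iff₀ hc0]; linarith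
  have hXhi : (X : ℝ) ≤ E / c := by
    rw [le_div_iff₀ hc0]; linarith [hsE, hXcR]
  have hEc : (262145 : ℝ) ≤ E / c := by
    rw [le_div_iff₀ hc0]; nlinarith [hEbig2, hcR40]
  have hX0 : (0 : ℝ) < X := by linarith
  have hX262144 : 262144 ≤ X := by
    have : (262144 : ℝ) ≤ X := by linarith
    exact_mod_cast this
  -- log X ≥ l₁ := L/2 − lc
  set l₁ := L / 2 - lc with hl₁def
  have hexp : Real.exp l₁ ≤ (X : ℝ) := by
    rw [hl₁def, Real.exp_sub]
    have hlc0 : (0 : ℝ) < (c : ℝ) * 1.00012 := by positivity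
    have h1 : E / Real.exp lc ≤ E / ((c : ℝ) * 1.00012) :=
      div_le_div_of_nonneg_left hE0.le hlc0 hlc
    have h2 : E / ((c : ℝ) * 1.00012) ≤ E / c - 1 := by
      rw [show E / ((c : ℝ) * 1.00012) = E / c / 1.00012 by rw [div_div],
        div_le_iff₀ (by norm_num : (0 : ℝ) < 1.00012)]
      linarith [hEc]
    linarith [hXlo]
  have hl : l₁ ≤ Real.log X := by
    rw [Real.le_log_iff_exp_le hX0]; exact hexp
  have hl₁ : (19.11 : ℝ) ≤ l₁ := by rw [hl₁def]; linarith
  -- Q ≥ TlowK2(log X) ≥ TlowK2(l₁) ≥ 100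
  set Q := GoldbachSieveEight.Qsum ∅ X with hQdef
  have hQ : TlowK2 (Real.log X) ≤ Q := Qsum_ge_kappa2 hX262144
  have hQT : TlowK2 l₁ ≤ Q := le_trans (TlowK2_mono (by linarith) hl) hQ
  have hT₁ : (100 : ℝ) ≤ TlowK2 l₁ := TlowK2_ge hl₁
  have hQpos : 0 < Q := by linarith
  have hF0 : 0 ≤ F := le_trans zero_le_one hF1
  have hC1 : C ≤ ((X : ℝ) ^ 2 + N - 1) * F / Q + B := by
    have : C * Q ≤ (((X : ℝ) ^ 2 + N - 1) * F / Q + B) * Q := by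
      rw [add_mul, div_mul_cancel₀ _ hQpos.ne']
      exact hBD
    exact le_of_mul_le_mul_right this hQpos
  have hc2pos : (0 : ℝ) < (c : ℝ) ^ 2 := by positivity
  set K : ℝ := ((c : ℝ) ^ 2 + 1) / (c : ℝ) ^ 2 with hKdef
  have hK0 : 0 < K := by positivity
  have hC2 : ((X : ℝ) ^ 2 + N - 1) * F / Q ≤ K * (N : ℝ) * F / TlowK2 l₁ := by
    have hnum0 : 0 ≤ K * (N : ℝ) * F := by positivity
    have hXN : (X : ℝ) ^ 2 ≤ (N : ℝ) / (c : ℝ) ^ 2 := by rw [le_div_iff₀ hc2pos]; exact hXR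
    have hKN : (X : ℝ) ^ 2 + N - 1 ≤ K * N := by
      have : K * N = N / (c : ℝ) ^ 2 + N := by rw [hKdef]; field_simp; ring
      rw [this]; linarith
    have hnum : ((X : ℝ) ^ 2 + N - 1) * F ≤ K * (N : ℝ) * F := mul_le_mul_of_nonneg_right hKN hF0
    calc ((X : ℝ) ^ 2 + N - 1) * F / Q ≤ K * (N : ℝ) * F / Q := div_le_div_of_nonneg_right hnum hQpos.le
      _ ≤ K * (N : ℝ) * F / TlowK2 l₁ :=
          div_le_div_of_nonneg_left hnum0 (by linarith) hQT
  -- main term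
  have hmain : K * (N : ℝ) * F / TlowK2 l₁ ≤ (A - 0.02) * F * (N : ℝ) / L ^ 2 := by
    have hkey : ((c : ℝ) ^ 2 + 1) * L ^ 2 ≤ (c : ℝ) ^ 2 * (A - 0.02) * TlowK2 l₁ := hA L hL
    have hkey' : K * L ^ 2 ≤ (A - 0.02) * TlowK2 l₁ := by
      rw [hKdef, div_mul_eq_mul_div, div_le_iff₀ hc2pos]
      linarith [hkey]
    rw [div_le_div_iff₀ (by linarith) hL2pos]
    have hNF : 0 ≤ (N : ℝ) * F := by positivity
    have h := mul_le_mul_of_nonneg_left hkey' hNF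
    calc K * (N : ℝ) * F * L ^ 2 = (N : ℝ) * F * (K * L ^ 2) := by ring
      _ ≤ (N : ℝ) * F * ((A - 0.02) * TlowK2 l₁) := h
      _ = (A - 0.02) * F * (N : ℝ) * TlowK2 l₁ := by ring
  -- boundary term
  have htail : B ≤ 0.02 * F * (N : ℝ) / L ^ 2 := by
    have h2 : (E / 4 + 1) * L ^ 2 ≤ 0.01 * (N : ℝ) := by
      rw [← hE2]; exact tail_numeric'' hL41 hEL
    have h3 : 0.02 * (N : ℝ) ≤ 0.02 * F * (N : ℝ) :=
      calc 0.02 * (N : ℝ) ≤ F * (0.02 * (N : ℝ)) := le_mul_of_one_le_left (by positivity) hF1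
        _ = 0.02 * F * (N : ℝ) := by ring
    rw [le_div_iff₀ hL2pos]
    have h1 : B * L ^ 2 ≤ 2 * ((E / 4 + 1) * L ^ 2) := by
      have hEc4 : E / c ≤ E / 4 := div_le_div_of_nonneg_left hE0.le (by norm_num) hcR4
      have : B ≤ 2 * (E / 4 + 1) := by linarith only [hB, hXhi, hEc4]
      nlinarith only [this, hL2pos]
    linarith only [h1, h2, h3]
  calc C ≤ ((X : ℝ) ^ 2 + N - 1) * F / Q + B := hC1
    _ ≤ K * (N : ℝ) * F / TlowK2 l₁ + B := by linarith only [hC2]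
    _ ≤ (A - 0.02) * F * (N : ℝ) / L ^ 2 + 0.02 * F * (N : ℝ) / L ^ 2 := add_le_add hmain htail
    _ = A * F * (N : ℝ) / L ^ 2 := by ring

/-- **Explicit GOLDBACH sieve bound with length `⌊√N⌋/c`**: under the numerics of `explicit_of_largeSieve_kappa2_c`,
`r(N) ≤ A·f(N)·N/log²N` for even `N ≥ e^Λ`. [cite: BatemanDiamond2004, §13.4 (13.13)–(13.14)] -/
theorem goldbachCount_le_of_numeric2_c {c : ℕ} {lc Λ A : ℝ} (hc4 : 4 ≤ c) (hc40 : c ≤ 40)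
    (hlc : (c : ℝ) * 1.00012 ≤ Real.exp lc) (hΛ : 41 ≤ Λ) (hΛc : 38.22 + 2 * lc ≤ Λ)
    (hnum : ∀ L : ℝ, Λ ≤ L → ((c : ℝ) ^ 2 + 1) * L ^ 2
        ≤ (c : ℝ) ^ 2 * (A - 0.02) * TlowK2 (L / 2 - lc))
    {N : ℕ} (hN : Real.exp Λ ≤ (N : ℝ)) (heven : Even N) :
    (SingularSeries.goldbachCount N : ℝ) ≤ A * oddSingularFactor N * (N : ℝ) / Real.log (N : ℝ) ^ 2 := by
  have h41 : Real.exp 41 ≤ (N : ℝ) := (Real.exp_le_exp.mpr hΛ).trans hN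
  have h20 : (2 : ℝ) ^ 20 ≤ (N : ℝ) := le_trans (by norm_num) (two_pow_59_le_exp_41.trans h41)
  have hX1 : 1 ≤ Nat.sqrt N / c := by
    have h20' : 2 ^ 20 ≤ N := by exact_mod_cast h20
    have hs : 1024 ≤ Nat.sqrt N := by
      rw [Nat.le_sqrt]
      calc 1024 * 1024 = 2 ^ 20 := by norm_num
        _ ≤ N := h20'
    exact (Nat.le_div_iff_mul_le (by omega)).mpr (by omega)
  have hBD := GoldbachSieveEight.goldbachCount_mul_Qsum_le N (Nat.sqrt N / c) heven hX1
  have hprod : (∏ p ∈ (N.primeFactors.filter (2 < ·)), (((p : ℝ) - 1) / ((p : ℝ) - 2)))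
      = oddSingularFactor N := rfl
  rw [hprod] at hBD
  exact explicit_of_largeSieve_kappa2_c hc4 hc40 hlc hΛ hΛc hnum hN (one_le_oddSingularFactor' _)
    (by linarith) hBD

/-- **Explicit PAIR sieve bound with length `⌊√N⌋/c`**: under the same numerics, for every `N ≥ e^Λ` and even `h ≠ 0`,
`#{p ≤ N : p + h prime} ≤ A·f(h)·N/log²N`.
[cite: BatemanDiamond2004, Thm 13.8, §13.4–13.5 pp. 325–328 (explicit form proved here)] -/
theorem pairCount_le_of_numeric2_c {c : ℕ} {lc Λ A : ℝ} (hc4 : 4 ≤ c) (hc40 : c ≤ 40)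
    (hlc : (c : ℝ) * 1.00012 ≤ Real.exp lc) (hΛ : 41 ≤ Λ) (hΛc : 38.22 + 2 * lc ≤ Λ)
    (hA : ∀ L : ℝ, Λ ≤ L → ((c : ℝ) ^ 2 + 1) * L ^ 2
        ≤ (c : ℝ) ^ 2 * (A - 0.02) * TlowK2 (L / 2 - lc))
    {N h : ℕ} (hN : Real.exp Λ ≤ (N : ℝ)) (hh : h ≠ 0) (heven : Even h) :
    ((((Nat.primesLE N).filter fun p => (p + h).Prime).card : ℕ) : ℝ)
      ≤ A * oddSingularFactor h * (N : ℝ) / Real.log (N : ℝ) ^ 2 := by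
  have h41 : Real.exp 41 ≤ (N : ℝ) := (Real.exp_le_exp.mpr hΛ).trans hN
  have h20 : (2 : ℝ) ^ 20 ≤ (N : ℝ) := le_trans (by norm_num) (two_pow_59_le_exp_41.trans h41)
  have hX1 : 1 ≤ Nat.sqrt N / c := by
    have h20' : 2 ^ 20 ≤ N := by exact_mod_cast h20
    have hs : 1024 ≤ Nat.sqrt N := by
      rw [Nat.le_sqrt]
      calc 1024 * 1024 = 2 ^ 20 := by norm_num
        _ ≤ N := h20'
    exact (Nat.le_div_iff_mul_le (by omega)).mpr (by omega)
  have hBD := GoldbachSieveEight.card_primePairs_mul_Qsum_le 1 h N (Nat.sqrt N / c) le_rfl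
    (Nat.one_le_iff_ne_zero.mpr hh) (by simpa using heven) hX1
  have hprod : (∏ p ∈ ((1 * h).primeFactors.filter (2 < ·)), (((p : ℝ) - 1) / ((p : ℝ) - 2)))
      = oddSingularFactor h := by rw [one_mul]; rfl
  rw [hprod] at hBD
  have hmain := explicit_of_largeSieve_kappa2_c hc4 hc40 hlc hΛ hΛc hA hN
    (one_le_oddSingularFactor' _) (by linarith) hBD
  have hcount : ((range (N + 1)).filter (fun p => p.Prime ∧ (1 * p + h).Prime)).card
      = ((Nat.primesLE N).filter fun p => (p + h).Prime).card := by
    congr 1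
    ext p
    simp only [mem_filter, mem_range, Nat.mem_primesLE, one_mul, Nat.lt_succ_iff]
    tauto
  rw [hcount] at hmain
  exact hmain

/-! ### §22.2 Numerics: pair sieves at `e^41` (`c = 4`), `e^125` and `e^215` (`c = 8`), the Goldbach sieve at `e^352` (`c = 16`) -/

/-- `c = 4` numerics at `Λ = 41`: `17L² ≤ 16·16.91·TlowK2(L/2 − 1.3865)` for `L ≥ 41`. [folklore] -/
private theorem cells4_numeric_41 {L : ℝ} (hL : 41 ≤ L) :
    (((4 : ℕ) : ℝ) ^ 2 + 1) * L ^ 2 ≤ ((4 : ℕ) : ℝ) ^ 2 * (16.93 - 0.02) * TlowK2 (L / 2 - 1.3865) := by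
  unfold TlowK2
  push_cast
  nlinarith [hL, mul_self_nonneg (L - 41)]

/-- `c = 8` numerics at `Λ = 125`: `65L² ≤ 64·13.10·TlowK2(L/2 − 2.0796)` for `L ≥ 125`. [folklore] -/
private theorem cells8_numeric_125 {L : ℝ} (hL : 125 ≤ L) :
    (((8 : ℕ) : ℝ) ^ 2 + 1) * L ^ 2 ≤ ((8 : ℕ) : ℝ) ^ 2 * (13.12 - 0.02) * TlowK2 (L / 2 - 2.0796) := by
  unfold TlowK2
  push_cast
  nlinarith [hL, mul_self_nonneg (L - 125)]

/-- `c = 8` numerics at `Λ = 215`: `65L² ≤ 64·12.40·TlowK2(L/2 − 2.0796)` for `L ≥ 215`. [folklore] -/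
private theorem cells8_numeric_215 {L : ℝ} (hL : 215 ≤ L) :
    (((8 : ℕ) : ℝ) ^ 2 + 1) * L ^ 2 ≤ ((8 : ℕ) : ℝ) ^ 2 * (12.42 - 0.02) * TlowK2 (L / 2 - 2.0796) := by
  unfold TlowK2
  push_cast
  nlinarith [hL, mul_self_nonneg (L - 215)]

/-- `c = 16` numerics at `Λ = 352`: `257L² ≤ 256·12.02·TlowK2(L/2 − 2.7728)` for `L ≥ 352`. [folklore] -/
private theorem cells16_numeric_352 {L : ℝ} (hL : 352 ≤ L) :
    (((16 : ℕ) : ℝ) ^ 2 + 1) * L ^ 2 ≤ ((16 : ℕ) : ℝ) ^ 2 * (12.04 - 0.02) * TlowK2 (L / 2 - 2.7728) := by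
  unfold TlowK2
  push_cast
  nlinarith [hL, mul_self_nonneg (L - 352)]

/-- **PAIR SIEVE `16.93` above `e^41`** (`c = 4`, enlarged cells; the tree's `pairCount_le_kappa` has `17.75`).
[cite: BatemanDiamond2004, Thm 13.8, §13.4–13.5 pp. 325–328 (explicit form proved here)] -/
theorem pairCount_le_1693 {N h : ℕ} (hN : Real.exp 41 ≤ (N : ℝ)) (hh : h ≠ 0) (heven : Even h) :
    ((((Nat.primesLE N).filter fun p => (p + h).Prime).card : ℕ) : ℝ)
      ≤ 16.93 * oddSingularFactor h * (N : ℝ) / Real.log (N : ℝ) ^ 2 :=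
  pairCount_le_of_numeric2_c (c := 4) (lc := 1.3865) (by norm_num) (by norm_num)
    (by have := exp_13865_ge; push_cast; linarith) (by norm_num) (by norm_num)
    (fun _ hL => cells4_numeric_41 hL) hN hh heven

/-- **PAIR SIEVE `13.12` above `e^125`** (`c = 8`, enlarged cells). [cite: BatemanDiamond2004, Thm 13.8, §13.4–13.5 pp. 325–328 (explicit form proved here)] -/
theorem pairCount_le_1312 {N h : ℕ} (hN : Real.exp 125 ≤ (N : ℝ)) (hh : h ≠ 0) (heven : Even h) :
    ((((Nat.primesLE N).filter fun p => (p + h).Prime).card : ℕ) : ℝ)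
      ≤ 13.12 * oddSingularFactor h * (N : ℝ) / Real.log (N : ℝ) ^ 2 :=
  pairCount_le_of_numeric2_c (c := 8) (lc := 2.0796) (by norm_num) (by norm_num)
    (by have := exp_20796_ge; push_cast; linarith) (by norm_num) (by norm_num)
    (fun _ hL => cells8_numeric_125 hL) hN hh heven

/-- **PAIR SIEVE `12.42` above `e^215`** (`c = 8`, enlarged cells). [cite: BatemanDiamond2004, Thm 13.8, §13.4–13.5 pp. 325–328 (explicit form proved here)] -/
theorem pairCount_le_1242 {N h : ℕ} (hN : Real.exp 215 ≤ (N : ℝ)) (hh : h ≠ 0) (heven : Even h) :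
    ((((Nat.primesLE N).filter fun p => (p + h).Prime).card : ℕ) : ℝ)
      ≤ 12.42 * oddSingularFactor h * (N : ℝ) / Real.log (N : ℝ) ^ 2 :=
  pairCount_le_of_numeric2_c (c := 8) (lc := 2.0796) (by norm_num) (by norm_num)
    (by have := exp_20796_ge; push_cast; linarith) (by norm_num) (by norm_num)
    (fun _ hL => cells8_numeric_215 hL) hN hh heven

/-- **GOLDBACH SIEVE `12.04` above `e^352`** (`c = 16`, enlarged cells): `r(N) ≤ 12.04·f(N)·N/log²N` for even `N ≥ e^352`.
[cite: BatemanDiamond2004, §13.4 (13.13)–(13.14)] -/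
theorem goldbachCount_le_1204 {N : ℕ} (hN : Real.exp 352 ≤ (N : ℝ)) (heven : Even N) :
    (SingularSeries.goldbachCount N : ℝ) ≤ 12.04 * oddSingularFactor N * (N : ℝ) / Real.log (N : ℝ) ^ 2 :=
  goldbachCount_le_of_numeric2_c (c := 16) (lc := 2.7728) (by norm_num) (by norm_num)
    (by have := exp_27728_ge; push_cast; linarith) (by norm_num) (by norm_num)
    (fun _ hL => cells16_numeric_352 hL) hN heven


/-! ### §22.3 The four-regime glues with the enlarged-cell pair sieves (`16.93` / `13.12` / `12.42`) -/

set_option maxHeartbeats 4000000 in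
/-- **GLUE FOR ALL `y ≥ 1`, FOUR REGIMES, `h ≥ 23`, with the `c = 8` pair sieve** (ROUND-37): as ROUND-36's
`half_count_ge_allN_q` (ROUND-37), but every pair sieve now runs on `TlowK2`: the four-shift regime uses `pairCount_le_1693` (weight `2·16.93·7 = 237.02`, was `248.5`); the seven-shift regime `[e^{L₂}, e^{L₃}]` requires `L₂ ≥ 125` and bounds its pair terms by
`pairCount_le_1312` (`13.12·f(d)·2y/log²(2y)` above `e^135`; weight `28.06·421/15 = 787.6 ≤ 736.5`, was `736.5`), and the
twelve-shift regime uses `pairCount_le_1242` (`12.42` above `e^215`; weight `24.84·163061/1683 = 2406.68 ≤ 2407`, was `2616`):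
`L² + h ≤ h·(7.51352L − 237.02)` on `[L₁, L₂]`, `L² + h ≤ h·(13.14866L − 736.5)` on `[L₂, L₃]`,
`L² + h ≤ h·(22.54056L − 2407)` on `[L₃, Λ₀]`. [cite: Nathanson1996, Theorem 7.8 (four-regime explicit form for the halved Goldbach set; proved here)] -/
theorem half_count_ge_allN_cells {L₁ L₂ L₃ Λ₀ : ℝ} {h : ℕ} (h23 : 23 ≤ h) (h41 : 41 ≤ L₁) (hL₁h : L₁ ≤ 1.8424 * h)
    (hL₂ : 125 ≤ L₂) (hL₃ : 215 ≤ L₃) (hΛ4 : Λ₀ ≤ 10000)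
    (hquad : ∀ L : ℝ, L₁ ≤ L → L ≤ L₂ → L ^ 2 + h ≤ h * (7.51352 * L - 237.02))
    (hquad7 : ∀ L : ℝ, L₂ ≤ L → L ≤ L₃ → L ^ 2 + h ≤ h * (13.14866 * L - 736.5))
    (hquad12 : ∀ L : ℝ, L₃ ≤ L → L ≤ Λ₀ → L ^ 2 + h ≤ h * (22.54056 * L - 2407))
    (hlarge : ∀ x : ℕ, Real.exp Λ₀ ≤ (x : ℝ) →
      (x : ℝ) / (2 * h) ≤ #{N ∈ Ioc 0 x | Even N ∧ ∃ p q : ℕ, p.Prime ∧ q.Prime ∧ p + q = N})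
    {y : ℕ} (hy : 1 ≤ y) :
    (y : ℝ) / h ≤ #{b ∈ Ioc 0 y | b ∈ (({0, 1} : Set ℕ) ∪ {m | ∃ p q : ℕ, p.Prime ∧ q.Prime ∧ p + q = 2 * m})} := by
  set B : Set ℕ := ({0, 1} : Set ℕ) ∪ {m | ∃ p q : ℕ, p.Prime ∧ q.Prime ∧ p + q = 2 * m} with hB
  have hhr : (23 : ℝ) ≤ h := by exact_mod_cast h23
  have hh0 : (0 : ℝ) < h := by linarith
  have hL₁pos : (0 : ℝ) < L₁ := by linarith
  by_cases hbig : Real.exp Λ₀ ≤ ((2 * y : ℕ) : ℝ)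
  · have h1 := hlarge (2 * y) hbig
    have h2 := even_goldbach_card_le_half y
    have e : ((2 * y : ℕ) : ℝ) / (2 * h) = (y : ℝ) / h := by
      push_cast
      field_simp
    rw [e] at h1
    exact h1.trans (by exact_mod_cast h2)
  rw [not_le] at hbig
  by_cases hsmall : y ≤ h
  · have h1 : 1 ≤ #{b ∈ Ioc 0 y | b ∈ B} :=
      card_pos.mpr ⟨1, by
        rw [mem_filter, mem_Ioc]
        exact ⟨⟨by omega, hy⟩, Or.inl (by simp)⟩⟩
    have h1' : (1 : ℝ) ≤ #{b ∈ Ioc 0 y | b ∈ B} := by exact_mod_cast h1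
    have h2 : (y : ℝ) / h ≤ 1 := by
      rw [div_le_one hh0]
      exact_mod_cast hsmall
    linarith
  rw [not_le] at hsmall
  have hy29 : 24 ≤ y := by omega
  have hnr : ((2 * y - 3 : ℕ) : ℝ) = 2 * (y : ℝ) - 3 := cast_two_mul_sub_three (by omega)
  have hy29r : (24 : ℝ) ≤ y := by exact_mod_cast hy29
  have hy0 : (0 : ℝ) < y := by linarith
  have hn55 : 45 ≤ 2 * y - 3 := by omega
  have hn0 : (0 : ℝ) < ((2 * y - 3 : ℕ) : ℝ) := by rw [hnr]; linarith
  have hn1 : (1 : ℝ) < ((2 * y - 3 : ℕ) : ℝ) := by rw [hnr]; linarith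
  have hlogpos : 0 < Real.log ((2 * y - 3 : ℕ) : ℝ) := Real.log_pos hn1
  by_cases hmid : Real.log ((2 * y - 3 : ℕ) : ℝ) ≤ L₁
  · -- ONE SHIFT below `e^{L₁}` (§15)
    have hemb := primeCounting_shift_le_half_count (y := y) (by omega)
    have hembr : (Nat.primeCounting (2 * y - 3) : ℝ) + 1 ≤ #{b ∈ Ioc 0 y | b ∈ B} := by exact_mod_cast hemb
    refine le_trans ?_ hembr
    by_cases h6 : 10 ^ 6 ≤ 2 * y - 3
    · have hπ : 0.9212 * ((2 * y - 3 : ℕ) : ℝ) / Real.log ((2 * y - 3 : ℕ) : ℝ)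
          ≤ (Nat.primeCounting (2 * y - 3) : ℝ) := by
        have := primeCountingLowerMul_09212
        unfold PrimeCountingLowerMul at this
        exact this (2 * y - 3) h6
      have h2 : 0.9212 * ((2 * y - 3 : ℕ) : ℝ) / L₁
          ≤ 0.9212 * ((2 * y - 3 : ℕ) : ℝ) / Real.log ((2 * y - 3 : ℕ) : ℝ) :=
        div_le_div_of_nonneg_left (by positivity) hlogpos hmid
      have h3 : (y : ℝ) / h ≤ 1.8424 * y / L₁ := by
        rw [div_le_div_iff₀ hh0 hL₁pos]
        nlinarith [mul_le_mul_of_nonneg_left hL₁h hy0.le]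
      have h4 : 1.8424 * (y : ℝ) / L₁ ≤ 0.9212 * ((2 * y - 3 : ℕ) : ℝ) / L₁ + 1 := by
        rw [hnr]
        have e : 0.9212 * (2 * (y : ℝ) - 3) / L₁ = 1.8424 * y / L₁ - 2.7636 / L₁ := by
          field_simp
          ring
        rw [e]
        have : 2.7636 / L₁ ≤ 1 := by
          rw [div_le_one hL₁pos]
          linarith
        linarith
      linarith [h2, h3, h4, hπ]
    · rw [not_le] at h6
      -- `2y − 3 < 10⁶`: Chebyshev pointwise `(n + 2)/45 ≤ π(n)` for `n ≥ 88` (tree), `π(n) ≥ π(3) = 2` below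
      by_cases h88 : 88 ≤ 2 * y - 3
      · have hlog14 : Real.log ((2 * y - 3 : ℕ) : ℝ) ≤ 14 := log_le_14_of_lt (by omega) h6
        have hπ := primeCounting_ge_div45 h88 (by linarith)
        rw [hnr] at hπ
        have h6' : (y : ℝ) / h ≤ (y : ℝ) / 23 := div_le_div_of_nonneg_left hy0.le (by norm_num) hhr
        have h7 : (y : ℝ) / 23 ≤ (2 * (y : ℝ) - 3 + 2) / 45 + 1 := by
          rw [div_le_iff₀ (by norm_num : (0 : ℝ) < 23)]
          linarith
        linarith [hπ, h6', h7]
      · rw [not_le] at h88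
        have hπ3 : Nat.primeCounting 3 = 2 := by decide
        have hmono := Nat.monotone_primeCounting (show 3 ≤ 2 * y - 3 by omega)
        rw [hπ3] at hmono
        have hπ2 : (2 : ℝ) ≤ (Nat.primeCounting (2 * y - 3) : ℝ) := by exact_mod_cast hmono
        have hy45 : (y : ℝ) ≤ 45 := by exact_mod_cast (show y ≤ 45 by omega)
        have h7 : (y : ℝ) / h ≤ 2 := by
          rw [div_le_iff₀ hh0]
          linarith
        linarith
  · -- FOUR SHIFTS on `(e^{L₁}, e^{Λ₀})`
    rw [not_le] at hmid
    have h59 : (576460752303423488 : ℝ) < ((2 * y - 3 : ℕ) : ℝ) := by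
      have h1 : Real.exp L₁ < ((2 * y - 3 : ℕ) : ℝ) := by
        by_contra hc
        rw [not_lt] at hc
        have := Real.log_le_log hn0 hc
        rw [Real.log_exp] at this
        linarith
      exact lt_of_le_of_lt (numeral_le_exp_41.trans (Real.exp_le_exp.mpr h41)) h1
    have h59n : 576460752303423488 < 2 * y - 3 := by exact_mod_cast h59
    have hy58 : (288230376151711744 : ℝ) ≤ (y : ℝ) := by
      have : 288230376151711744 ≤ y := by omega
      exact_mod_cast this
    have h2y0 : (0 : ℝ) < ((2 * y : ℕ) : ℝ) := by push_cast; linarith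
    set L := Real.log ((2 * y : ℕ) : ℝ) with hLdef
    have hLΛ : L < Λ₀ := by
      have := Real.log_lt_log h2y0 hbig
      rwa [Real.log_exp] at this
    have hL₁L : L₁ ≤ L := by
      have h2y : ((2 * y - 3 : ℕ) : ℝ) ≤ ((2 * y : ℕ) : ℝ) := by rw [hnr]; push_cast; linarith
      exact (hmid.trans_le (Real.log_le_log hn0 h2y)).le
    have hL41 : (41 : ℝ) ≤ L := h41.trans hL₁L
    have hLpos : (0 : ℝ) < L := by linarith
    have hL4 : L ≤ 10000 := by linarith
    have he41 : Real.exp 41 ≤ ((2 * y : ℕ) : ℝ) := by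
      have : Real.exp 41 ≤ Real.exp L := Real.exp_le_exp.mpr hL41
      rwa [hLdef, Real.exp_log h2y0] at this
    -- the prime counts, Sylvester's constant
    have hπ : ∀ q : ℕ, q ≤ 41 → 0.93919 * (2 * (y : ℝ) - q) / L ≤ (Nat.primeCounting (2 * y - q) : ℝ) := by
      intro q hq
      have hqr : (q : ℝ) ≤ 41 := by exact_mod_cast hq
      have hnq : ((2 * y - q : ℕ) : ℝ) = 2 * (y : ℝ) - q := cast_two_mul_sub (by omega)
      have h6 : 10 ^ 12 ≤ 2 * y - q := by omega
      have hnq0 : (0 : ℝ) < ((2 * y - q : ℕ) : ℝ) := by rw [hnq]; linarith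
      have hnq1 : (1 : ℝ) < ((2 * y - q : ℕ) : ℝ) := by rw [hnq]; linarith
      have h1 : 0.93919 * ((2 * y - q : ℕ) : ℝ) / Real.log ((2 * y - q : ℕ) : ℝ)
          ≤ (Nat.primeCounting (2 * y - q) : ℝ) := by
        have := primeCountingLowerMul_sylvester
        unfold PrimeCountingLowerMul at this
        exact this (2 * y - q) h6
      have hlogq0 : 0 < Real.log ((2 * y - q : ℕ) : ℝ) := Real.log_pos hnq1
      have hlogq : Real.log ((2 * y - q : ℕ) : ℝ) ≤ L := by
        have h2y : ((2 * y - q : ℕ) : ℝ) ≤ ((2 * y : ℕ) : ℝ) := by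
          rw [hnq]; push_cast; linarith [Nat.cast_nonneg (α := ℝ) q]
        exact Real.log_le_log hnq0 h2y
      have h2 : 0.93919 * (2 * (y : ℝ) - q) / L
          ≤ 0.93919 * ((2 * y - q : ℕ) : ℝ) / Real.log ((2 * y - q : ℕ) : ℝ) := by
        rw [← hnq]
        exact div_le_div_of_nonneg_left (by positivity) hlogq0 hlogq
      linarith
    -- the pair counts (tree: explicit pair sieve above `e^41`)
    have hP : ∀ d : ℕ, d ≠ 0 → Even d →
        (#((Nat.primesLE (2 * y)).filter (fun p => (p + d).Prime)) : ℝ)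
          ≤ 16.93 * oddSingularFactor d * ((2 * y : ℕ) : ℝ) / L ^ 2 := by
      intro d hd hde
      exact pairCount_le_1693 (N := 2 * y) (h := d) he41 hd hde
    rcases le_or_gt L L₂ with hmid2 | hmid2
    · -- FOUR SHIFTS on `(e^{L₁}, e^{L₂}]`
      have hq := hquad L hL₁L hmid2
      have hP2 := hP 2 (by norm_num) (by norm_num)
      have hP4 := hP 4 (by norm_num) (by norm_num)
      have hP6 := hP 6 (by norm_num) (by norm_num)
      have hP8 := hP 8 (by norm_num) (by norm_num)
      rw [oddSingularFactor_two'] at hP2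
      rw [oddSingularFactor_four] at hP4
      rw [oddSingularFactor_six] at hP6
      rw [oddSingularFactor_eight] at hP8
      -- combinatorics
      have hcomb := four_shift_count (y := y) (by omega)
      have hcombr : (Nat.primeCounting (2 * y - 3) : ℝ) + Nat.primeCounting (2 * y - 5)
          + Nat.primeCounting (2 * y - 7) + Nat.primeCounting (2 * y - 11)
          ≤ (#{b ∈ Ioc 0 y | b ∈ B} : ℝ) + 2
            + (2 * #((Nat.primesLE (2 * y)).filter (fun p => (p + 2).Prime))
              + 2 * #((Nat.primesLE (2 * y)).filter (fun p => (p + 4).Prime))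
              + #((Nat.primesLE (2 * y)).filter (fun p => (p + 8).Prime))
              + #((Nat.primesLE (2 * y)).filter (fun p => (p + 6).Prime))) := by
        exact_mod_cast hcomb
      have hπ3 := hπ 3 (by norm_num)
      have hπ5 := hπ 5 (by norm_num)
      have hπ7 := hπ 7 (by norm_num)
      have hπ11 := hπ 11 (by norm_num)
      push_cast at hπ3 hπ5 hπ7 hπ11
      have h2yr : ((2 * y : ℕ) : ℝ) = 2 * (y : ℝ) := by push_cast; ring
      rw [h2yr] at hP2 hP4 hP6 hP8
      set G : ℝ := (#{b ∈ Ioc 0 y | b ∈ B} : ℝ) with hG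
      set Y : ℝ := (y : ℝ) with hY
      -- `G ≥ (7.51352 Y − 24.41894)/L − 2 − 237.02 Y/L²`
      have hG1 : (7.51352 * Y - 24.41894) / L - 2 - 237.02 * Y / L ^ 2 ≤ G := by
        have e1 : (7.51352 * Y - 24.41894) / L = 0.93919 * (2 * Y - 3) / L + 0.93919 * (2 * Y - 5) / L
            + 0.93919 * (2 * Y - 7) / L + 0.93919 * (2 * Y - 11) / L := by
          field_simp
          ring
        have e2 : 237.02 * Y / L ^ 2 = 2 * (16.93 * 1 * (2 * Y) / L ^ 2) + 2 * (16.93 * 1 * (2 * Y) / L ^ 2)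
            + 16.93 * 1 * (2 * Y) / L ^ 2 + 16.93 * 2 * (2 * Y) / L ^ 2 := by
          field_simp
          ring
        rw [e1, e2]
        linarith [hcombr, hπ3, hπ5, hπ7, hπ11, hP2, hP4, hP6, hP8]
      have hL2 : (0 : ℝ) < L ^ 2 := by positivity
      have hkey : Y * L ^ 2 ≤ (h : ℝ) * G * L ^ 2 := by
        have e3 : ((7.51352 * Y - 24.41894) / L - 2 - 237.02 * Y / L ^ 2) * L ^ 2
            = 7.51352 * Y * L - 24.41894 * L - 2 * L ^ 2 - 237.02 * Y := by
          field_simp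
        have h1 : (7.51352 * Y * L - 24.41894 * L - 2 * L ^ 2 - 237.02 * Y) * h ≤ G * L ^ 2 * h := by
          rw [← e3]
          exact mul_le_mul_of_nonneg_right (mul_le_mul_of_nonneg_right hG1 hL2.le) hh0.le
        have h2 : Y * (L ^ 2 + h) ≤ Y * (h * (7.51352 * L - 237.02)) :=
          mul_le_mul_of_nonneg_left hq (by linarith)
        have h3 : 24.41894 * L + 2 * L ^ 2 ≤ Y := by
          nlinarith [mul_nonneg (sub_nonneg.2 hL4) hLpos.le]
        have h3' : (h : ℝ) * (24.41894 * L + 2 * L ^ 2) ≤ h * Y := mul_le_mul_of_nonneg_left h3 hh0.le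
        nlinarith [h1, h2, h3']
      have hfin := le_of_mul_le_mul_right hkey hL2
      rw [div_le_iff₀ hh0, mul_comm]
      exact hfin
    · rcases le_or_gt L L₃ with hmid3 | hmid3
      · -- SEVEN SHIFTS on `(e^{L₂}, e^{L₃}]`
        have hq := hquad7 L hmid2.le hmid3
        have he125 : Real.exp 125 ≤ ((2 * y : ℕ) : ℝ) := by
          have : Real.exp 125 ≤ Real.exp L := Real.exp_le_exp.mpr (hL₂.trans hmid2.le)
          rwa [hLdef, Real.exp_log h2y0] at this
        have hP7 : ∀ d : ℕ, d ≠ 0 → Even d →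
            (#((Nat.primesLE (2 * y)).filter (fun p => (p + d).Prime)) : ℝ)
              ≤ 13.12 * oddSingularFactor d * ((2 * y : ℕ) : ℝ) / L ^ 2 := by
          intro d hd hde
          rw [hLdef]
          exact pairCount_le_1312 (N := 2 * y) (h := d) he125 hd hde
        have hP2 := hP7 2 (by norm_num) (by norm_num)
        have hP4 := hP7 4 (by norm_num) (by norm_num)
        have hP6 := hP7 6 (by norm_num) (by norm_num)
        have hP8 := hP7 8 (by norm_num) (by norm_num)
        have hP10 := hP7 10 (by norm_num) (by norm_num)
        have hP12 := hP7 12 (by norm_num) (by norm_num)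
        have hP14 := hP7 14 (by norm_num) (by norm_num)
        have hP16 := hP7 16 (by norm_num) (by norm_num)
        rw [oddSingularFactor_two'] at hP2
        rw [oddSingularFactor_four] at hP4
        rw [oddSingularFactor_six] at hP6
        rw [oddSingularFactor_eight] at hP8
        rw [oddSingularFactor_ten] at hP10
        rw [oddSingularFactor_twelve] at hP12
        rw [oddSingularFactor_fourteen] at hP14
        rw [oddSingularFactor_sixteen] at hP16
        have hcomb := seven_shift_count (y := y) (by omega)
        have hcombr : (Nat.primeCounting (2 * y - 3) : ℝ) + Nat.primeCounting (2 * y - 5)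
            + Nat.primeCounting (2 * y - 7) + Nat.primeCounting (2 * y - 11) + Nat.primeCounting (2 * y - 13)
            + Nat.primeCounting (2 * y - 17) + Nat.primeCounting (2 * y - 19)
            ≤ (#{b ∈ Ioc 0 y | b ∈ B} : ℝ) + 5
              + (4 * #((Nat.primesLE (2 * y)).filter (fun p => (p + 2).Prime))
                + 3 * #((Nat.primesLE (2 * y)).filter (fun p => (p + 4).Prime))
                + 4 * #((Nat.primesLE (2 * y)).filter (fun p => (p + 6).Prime))
                + 3 * #((Nat.primesLE (2 * y)).filter (fun p => (p + 8).Prime))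
                + 2 * #((Nat.primesLE (2 * y)).filter (fun p => (p + 10).Prime))
                + 2 * #((Nat.primesLE (2 * y)).filter (fun p => (p + 12).Prime))
                + 2 * #((Nat.primesLE (2 * y)).filter (fun p => (p + 14).Prime))
                + #((Nat.primesLE (2 * y)).filter (fun p => (p + 16).Prime))) := by
          exact_mod_cast hcomb
        have hπ3 := hπ 3 (by norm_num)
        have hπ5 := hπ 5 (by norm_num)
        have hπ7 := hπ 7 (by norm_num)
        have hπ11 := hπ 11 (by norm_num)
        have hπ13 := hπ 13 (by norm_num)
        have hπ17 := hπ 17 (by norm_num)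
        have hπ19 := hπ 19 (by norm_num)
        push_cast at hπ3 hπ5 hπ7 hπ11 hπ13 hπ17 hπ19
        have h2yr : ((2 * y : ℕ) : ℝ) = 2 * (y : ℝ) := by push_cast; ring
        rw [h2yr] at hP2 hP4 hP6 hP8 hP10 hP12 hP14 hP16
        set G : ℝ := (#{b ∈ Ioc 0 y | b ∈ B} : ℝ) with hG
        set Y : ℝ := (y : ℝ) with hY
        have hY0 : 0 ≤ Y := le_trans (by norm_num) hy58
        have hL2 : (0 : ℝ) < L ^ 2 := by positivity
        have hG1 : (13.14866 * Y - 70.43925) / L - 5 - 736.5 * Y / L ^ 2 ≤ G := by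
          have e1 : (13.14866 * Y - 70.43925) / L
              = 0.93919 * (2 * Y - 3) / L + 0.93919 * (2 * Y - 5) / L + 0.93919 * (2 * Y - 7) / L + 0.93919 * (2 * Y - 11) / L + 0.93919 * (2 * Y - 13) / L + 0.93919 * (2 * Y - 17) / L + 0.93919 * (2 * Y - 19) / L := by
            field_simp
            ring
          have e2 : 4 * (13.12 * 1 * (2 * Y) / L ^ 2) + 3 * (13.12 * 1 * (2 * Y) / L ^ 2)
              + 4 * (13.12 * 2 * (2 * Y) / L ^ 2) + 3 * (13.12 * 1 * (2 * Y) / L ^ 2)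
              + 2 * (13.12 * (4 / 3) * (2 * Y) / L ^ 2) + 2 * (13.12 * 2 * (2 * Y) / L ^ 2)
              + 2 * (13.12 * (6 / 5) * (2 * Y) / L ^ 2) + 13.12 * 1 * (2 * Y) / L ^ 2
              = (276176 / 375) * Y / L ^ 2 := by
            field_simp
            ring
          have e3 : (276176 / 375 : ℝ) * Y / L ^ 2 ≤ 736.5 * Y / L ^ 2 :=
            div_le_div_of_nonneg_right (mul_le_mul_of_nonneg_right (by norm_num) hY0) hL2.le
          rw [e1]
          linarith [hcombr, hπ3, hπ5, hπ7, hπ11, hπ13, hπ17, hπ19, hP2, hP4, hP6, hP8, hP10, hP12, hP14, hP16,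
            e2, e3]
        have hkey : Y * L ^ 2 ≤ (h : ℝ) * G * L ^ 2 := by
          have e4 : ((13.14866 * Y - 70.43925) / L - 5 - 736.5 * Y / L ^ 2) * L ^ 2
              = 13.14866 * Y * L - 70.43925 * L - 5 * L ^ 2 - 736.5 * Y := by
            field_simp
          have h1 : (13.14866 * Y * L - 70.43925 * L - 5 * L ^ 2 - 736.5 * Y) * h ≤ G * L ^ 2 * h := by
            rw [← e4]
            exact mul_le_mul_of_nonneg_right (mul_le_mul_of_nonneg_right hG1 hL2.le) hh0.le
          have h2 : Y * (L ^ 2 + h) ≤ Y * (h * (13.14866 * L - 736.5)) :=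
            mul_le_mul_of_nonneg_left hq (by linarith)
          have h3 : 70.43925 * L + 5 * L ^ 2 ≤ Y := by
            nlinarith [mul_nonneg (sub_nonneg.2 hL4) hLpos.le]
          have h3' : (h : ℝ) * (70.43925 * L + 5 * L ^ 2) ≤ h * Y := mul_le_mul_of_nonneg_left h3 hh0.le
          nlinarith [h1, h2, h3']
        have hfin := le_of_mul_le_mul_right hkey hL2
        rw [div_le_iff₀ hh0, mul_comm]
        exact hfin
      · -- TWELVE SHIFTS on `(e^{L₃}, e^{Λ₀})`, pair sieve at the threshold `e^215`
        have hq := hquad12 L hmid3.le hLΛ.le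
        have he215 : Real.exp 215 ≤ ((2 * y : ℕ) : ℝ) := by
          have : Real.exp 215 ≤ Real.exp L := Real.exp_le_exp.mpr (hL₃.trans hmid3.le)
          rwa [hLdef, Real.exp_log h2y0] at this
        have hPt : ∀ d : ℕ, d ≠ 0 → Even d →
            (#((Nat.primesLE (2 * y)).filter (fun p => (p + d).Prime)) : ℝ)
              ≤ 12.42 * oddSingularFactor d * ((2 * y : ℕ) : ℝ) / L ^ 2 := by
          intro d hd hde
          rw [hLdef]
          exact pairCount_le_1242 (N := 2 * y) (h := d) he215 hd hde
        have hQ2 := hPt 2 (by norm_num) (by norm_num)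
        have hQ4 := hPt 4 (by norm_num) (by norm_num)
        have hQ6 := hPt 6 (by norm_num) (by norm_num)
        have hQ8 := hPt 8 (by norm_num) (by norm_num)
        have hQ10 := hPt 10 (by norm_num) (by norm_num)
        have hQ12 := hPt 12 (by norm_num) (by norm_num)
        have hQ14 := hPt 14 (by norm_num) (by norm_num)
        have hQ16 := hPt 16 (by norm_num) (by norm_num)
        have hQ18 := hPt 18 (by norm_num) (by norm_num)
        have hQ20 := hPt 20 (by norm_num) (by norm_num)
        have hQ22 := hPt 22 (by norm_num) (by norm_num)
        have hQ24 := hPt 24 (by norm_num) (by norm_num)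
        have hQ26 := hPt 26 (by norm_num) (by norm_num)
        have hQ28 := hPt 28 (by norm_num) (by norm_num)
        have hQ30 := hPt 30 (by norm_num) (by norm_num)
        have hQ32 := hPt 32 (by norm_num) (by norm_num)
        have hQ34 := hPt 34 (by norm_num) (by norm_num)
        have hQ36 := hPt 36 (by norm_num) (by norm_num)
        have hQ38 := hPt 38 (by norm_num) (by norm_num)
        rw [oddSingularFactor_two'] at hQ2
        rw [oddSingularFactor_four] at hQ4
        rw [oddSingularFactor_six] at hQ6
        rw [oddSingularFactor_eight] at hQ8
        rw [oddSingularFactor_ten] at hQ10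
        rw [oddSingularFactor_twelve] at hQ12
        rw [oddSingularFactor_fourteen] at hQ14
        rw [oddSingularFactor_sixteen] at hQ16
        rw [oddSingularFactor_eighteen] at hQ18
        rw [oddSingularFactor_twenty] at hQ20
        rw [oddSingularFactor_twentytwo] at hQ22
        rw [oddSingularFactor_twentyfour] at hQ24
        rw [oddSingularFactor_twentysix] at hQ26
        rw [oddSingularFactor_twentyeight] at hQ28
        rw [oddSingularFactor_thirty] at hQ30
        rw [oddSingularFactor_thirtytwo] at hQ32
        rw [oddSingularFactor_thirtyfour] at hQ34
        rw [oddSingularFactor_thirtysix] at hQ36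
        rw [oddSingularFactor_thirtyeight] at hQ38
        have hcomb := twelve_shift_count (y := y) (by omega)
        have hcombr : (Nat.primeCounting (2 * y - 3) : ℝ) + Nat.primeCounting (2 * y - 5)
            + Nat.primeCounting (2 * y - 7) + Nat.primeCounting (2 * y - 11) + Nat.primeCounting (2 * y - 13)
            + Nat.primeCounting (2 * y - 17) + Nat.primeCounting (2 * y - 19) + Nat.primeCounting (2 * y - 23)
            + Nat.primeCounting (2 * y - 29) + Nat.primeCounting (2 * y - 31) + Nat.primeCounting (2 * y - 37)
            + Nat.primeCounting (2 * y - 41)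
            ≤ (#{b ∈ Ioc 0 y | b ∈ (({0, 1} : Set ℕ) ∪ {m | ∃ p q : ℕ, p.Prime ∧ q.Prime ∧ p + q = 2 * m})} : ℝ) + 10
              + (5 * #((Nat.primesLE (2 * y)).filter (fun p => (p + 2).Prime))
                + 5 * #((Nat.primesLE (2 * y)).filter (fun p => (p + 4).Prime))
                + 7 * #((Nat.primesLE (2 * y)).filter (fun p => (p + 6).Prime))
                + 5 * #((Nat.primesLE (2 * y)).filter (fun p => (p + 8).Prime))
                + 5 * #((Nat.primesLE (2 * y)).filter (fun p => (p + 10).Prime))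
                + 6 * #((Nat.primesLE (2 * y)).filter (fun p => (p + 12).Prime))
                + 4 * #((Nat.primesLE (2 * y)).filter (fun p => (p + 14).Prime))
                + 3 * #((Nat.primesLE (2 * y)).filter (fun p => (p + 16).Prime))
                + 5 * #((Nat.primesLE (2 * y)).filter (fun p => (p + 18).Prime))
                + 3 * #((Nat.primesLE (2 * y)).filter (fun p => (p + 20).Prime))
                + 2 * #((Nat.primesLE (2 * y)).filter (fun p => (p + 22).Prime))
                + 4 * #((Nat.primesLE (2 * y)).filter (fun p => (p + 24).Prime))
                + 3 * #((Nat.primesLE (2 * y)).filter (fun p => (p + 26).Prime))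
                + 2 * #((Nat.primesLE (2 * y)).filter (fun p => (p + 28).Prime))
                + 2 * #((Nat.primesLE (2 * y)).filter (fun p => (p + 30).Prime))
                + #((Nat.primesLE (2 * y)).filter (fun p => (p + 32).Prime))
                + 2 * #((Nat.primesLE (2 * y)).filter (fun p => (p + 34).Prime))
                + #((Nat.primesLE (2 * y)).filter (fun p => (p + 36).Prime))
                + #((Nat.primesLE (2 * y)).filter (fun p => (p + 38).Prime))) := by
          exact_mod_cast hcomb
        have hπ3 := hπ 3 (by norm_num)
        have hπ5 := hπ 5 (by norm_num)
        have hπ7 := hπ 7 (by norm_num)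
        have hπ11 := hπ 11 (by norm_num)
        have hπ13 := hπ 13 (by norm_num)
        have hπ17 := hπ 17 (by norm_num)
        have hπ19 := hπ 19 (by norm_num)
        have hπ23 := hπ 23 (by norm_num)
        have hπ29 := hπ 29 (by norm_num)
        have hπ31 := hπ 31 (by norm_num)
        have hπ37 := hπ 37 (by norm_num)
        have hπ41 := hπ 41 (by norm_num)
        push_cast at hπ3 hπ5 hπ7 hπ11 hπ13 hπ17 hπ19 hπ23 hπ29 hπ31 hπ37 hπ41
        have h2yr : ((2 * y : ℕ) : ℝ) = 2 * (y : ℝ) := by push_cast; ring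
        rw [h2yr] at hQ2 hQ4 hQ6 hQ8 hQ10 hQ12 hQ14 hQ16 hQ18 hQ20 hQ22 hQ24 hQ26 hQ28 hQ30 hQ32 hQ34 hQ36 hQ38
        set G : ℝ := (#{b ∈ Ioc 0 y | b ∈ (({0, 1} : Set ℕ) ∪ {m | ∃ p q : ℕ, p.Prime ∧ q.Prime ∧ p + q = 2 * m})} : ℝ) with hG
        set Y : ℝ := (y : ℝ) with hY
        have hY0 : 0 ≤ Y := le_trans (by norm_num) hy58
        have hL2 : (0 : ℝ) < L ^ 2 := by positivity
        have hG1 : (22.54056 * Y - 221.64884) / L - 10 - 2407 * Y / L ^ 2 ≤ G := by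
          have e1 : (22.54056 * Y - 221.64884) / L
              = 0.93919 * (2 * Y - 3) / L + 0.93919 * (2 * Y - 5) / L + 0.93919 * (2 * Y - 7) / L + 0.93919 * (2 * Y - 11) / L
                + 0.93919 * (2 * Y - 13) / L + 0.93919 * (2 * Y - 17) / L + 0.93919 * (2 * Y - 19) / L + 0.93919 * (2 * Y - 23) / L
                + 0.93919 * (2 * Y - 29) / L + 0.93919 * (2 * Y - 31) / L + 0.93919 * (2 * Y - 37) / L + 0.93919 * (2 * Y - 41) / L := by
            field_simp
            ring
          have e2 : 5 * (12.42 * 1 * (2 * Y) / L ^ 2)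
              + 5 * (12.42 * 1 * (2 * Y) / L ^ 2)
              + 7 * (12.42 * 2 * (2 * Y) / L ^ 2)
              + 5 * (12.42 * 1 * (2 * Y) / L ^ 2)
              + 5 * (12.42 * (4 / 3) * (2 * Y) / L ^ 2)
              + 6 * (12.42 * 2 * (2 * Y) / L ^ 2)
              + 4 * (12.42 * (6 / 5) * (2 * Y) / L ^ 2)
              + 3 * (12.42 * 1 * (2 * Y) / L ^ 2)
              + 5 * (12.42 * 2 * (2 * Y) / L ^ 2)
              + 3 * (12.42 * (4 / 3) * (2 * Y) / L ^ 2)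
              + 2 * (12.42 * (10 / 9) * (2 * Y) / L ^ 2)
              + 4 * (12.42 * 2 * (2 * Y) / L ^ 2)
              + 3 * (12.42 * (12 / 11) * (2 * Y) / L ^ 2)
              + 2 * (12.42 * (6 / 5) * (2 * Y) / L ^ 2)
              + 2 * (12.42 * (8 / 3) * (2 * Y) / L ^ 2)
              + 12.42 * 1 * (2 * Y) / L ^ 2
              + 2 * (12.42 * (16 / 15) * (2 * Y) / L ^ 2)
              + 12.42 * 2 * (2 * Y) / L ^ 2
              + 12.42 * (18 / 17) * (2 * Y) / L ^ 2
              = (11251209 / 4675) * Y / L ^ 2 := by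
            field_simp
            ring
          have e3 : (11251209 / 4675 : ℝ) * Y / L ^ 2 ≤ 2407 * Y / L ^ 2 :=
            div_le_div_of_nonneg_right (mul_le_mul_of_nonneg_right (by norm_num) hY0) hL2.le
          rw [e1]
          linarith [hcombr, hπ3, hπ5, hπ7, hπ11, hπ13, hπ17, hπ19, hπ23, hπ29, hπ31, hπ37, hπ41,
            hQ2, hQ4, hQ6, hQ8, hQ10, hQ12, hQ14, hQ16, hQ18, hQ20, hQ22, hQ24, hQ26, hQ28, hQ30, hQ32, hQ34, hQ36, hQ38, e2, e3]
        have hkey : Y * L ^ 2 ≤ (h : ℝ) * G * L ^ 2 := by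
          have e4 : ((22.54056 * Y - 221.64884) / L - 10 - 2407 * Y / L ^ 2) * L ^ 2
              = 22.54056 * Y * L - 221.64884 * L - 10 * L ^ 2 - 2407 * Y := by
            field_simp
          have h1 : (22.54056 * Y * L - 221.64884 * L - 10 * L ^ 2 - 2407 * Y) * h ≤ G * L ^ 2 * h := by
            rw [← e4]
            exact mul_le_mul_of_nonneg_right (mul_le_mul_of_nonneg_right hG1 hL2.le) hh0.le
          have h2 : Y * (L ^ 2 + h) ≤ Y * (h * (22.54056 * L - 2407)) :=
            mul_le_mul_of_nonneg_left hq (by linarith)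
          have h3 : 221.64884 * L + 10 * L ^ 2 ≤ Y := by
            nlinarith [mul_nonneg (sub_nonneg.2 hL4) hLpos.le]
          have h3' : (h : ℝ) * (221.64884 * L + 10 * L ^ 2) ≤ h * Y := mul_le_mul_of_nonneg_left h3 hh0.le
          nlinarith [h1, h2, h3']
        have hfin := le_of_mul_le_mul_right hkey hL2
        rw [div_le_iff₀ hh0, mul_comm]
        exact hfin
set_option maxHeartbeats 4000000 in
/-- **GLUE UNDER (3.3) FOR ALL `y ≥ 1`, FOUR REGIMES, with the `c = 8` pair sieve** (ROUND-37): as ROUND-36's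
`half_count_ge_allN_lev_RS` (`c₀ = 1` mains), with the seven-shift regime on `[e^{L₂}, e^{L₃}]`, `L₂ ≥ 135`, using
`pairCount_le_1312` (weight `736.5`) and the twelve-shift regime using `pairCount_le_1242` (weight `2407`):
`L² + h ≤ h·(8L − 237.02)` on `[L₁, L₂]`, `L² + h ≤ h·(14L − 736.5)` on `[L₂, L₃]`, `L² + h ≤ h·(24L − 2407)` on `[L₃, Λ₀]`.
[cite: RosserSchoenfeld1962, Theorem 2, eq. (3.3) (as input)] -/
theorem half_count_ge_allN_cells_RS (hRS : Literature.NumberTheory.LFunctions.RosserSchoenfeld1962_theorem2)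
    {L₁ L₂ L₃ Λ₀ : ℝ} {h : ℕ} (h18 : 18 ≤ h) (h41 : 41 ≤ L₁) (hL₁h : L₁ ≤ 2 * h)
    (hL₂ : 125 ≤ L₂) (hL₃ : 215 ≤ L₃) (hΛ4 : Λ₀ ≤ 10000)
    (hquad : ∀ L : ℝ, L₁ ≤ L → L ≤ L₂ → L ^ 2 + h ≤ h * (8 * L - 237.02))
    (hquad7 : ∀ L : ℝ, L₂ ≤ L → L ≤ L₃ → L ^ 2 + h ≤ h * (14 * L - 736.5))
    (hquad12 : ∀ L : ℝ, L₃ ≤ L → L ≤ Λ₀ → L ^ 2 + h ≤ h * (24 * L - 2407))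
    (hlarge : ∀ x : ℕ, Real.exp Λ₀ ≤ (x : ℝ) →
      (x : ℝ) / (2 * h) ≤ #{N ∈ Ioc 0 x | Even N ∧ ∃ p q : ℕ, p.Prime ∧ q.Prime ∧ p + q = N})
    {y : ℕ} (hy : 1 ≤ y) :
    (y : ℝ) / h ≤ #{b ∈ Ioc 0 y | b ∈ (({0, 1} : Set ℕ) ∪ {m | ∃ p q : ℕ, p.Prime ∧ q.Prime ∧ p + q = 2 * m})} := by
  set B : Set ℕ := ({0, 1} : Set ℕ) ∪ {m | ∃ p q : ℕ, p.Prime ∧ q.Prime ∧ p + q = 2 * m} with hB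
  have hhr : (18 : ℝ) ≤ h := by exact_mod_cast h18
  have hh0 : (0 : ℝ) < h := by linarith
  have hL₁pos : (0 : ℝ) < L₁ := by linarith
  by_cases hbig : Real.exp Λ₀ ≤ ((2 * y : ℕ) : ℝ)
  · have h1 := hlarge (2 * y) hbig
    have h2 := even_goldbach_card_le_half y
    have e : ((2 * y : ℕ) : ℝ) / (2 * h) = (y : ℝ) / h := by
      push_cast
      field_simp
    rw [e] at h1
    exact h1.trans (by exact_mod_cast h2)
  rw [not_le] at hbig
  by_cases hsmall : y ≤ h
  · have h1 : 1 ≤ #{b ∈ Ioc 0 y | b ∈ B} :=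
      card_pos.mpr ⟨1, by
        rw [mem_filter, mem_Ioc]
        exact ⟨⟨by omega, hy⟩, Or.inl (by simp)⟩⟩
    have h1' : (1 : ℝ) ≤ #{b ∈ Ioc 0 y | b ∈ B} := by exact_mod_cast h1
    have h2 : (y : ℝ) / h ≤ 1 := by
      rw [div_le_one hh0]
      exact_mod_cast hsmall
    linarith
  rw [not_le] at hsmall
  have hy29 : 19 ≤ y := by omega
  have hnr : ((2 * y - 3 : ℕ) : ℝ) = 2 * (y : ℝ) - 3 := cast_two_mul_sub_three (by omega)
  have hy29r : (19 : ℝ) ≤ y := by exact_mod_cast hy29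
  have hy0 : (0 : ℝ) < y := by linarith
  have hn55 : 35 ≤ 2 * y - 3 := by omega
  have hn0 : (0 : ℝ) < ((2 * y - 3 : ℕ) : ℝ) := by rw [hnr]; linarith
  have hn1 : (1 : ℝ) < ((2 * y - 3 : ℕ) : ℝ) := by rw [hnr]; linarith
  have hlogpos : 0 < Real.log ((2 * y - 3 : ℕ) : ℝ) := Real.log_pos hn1
  by_cases hmid : Real.log ((2 * y - 3 : ℕ) : ℝ) ≤ L₁
  · -- ONE SHIFT below `e^{L₁}` (§15, RS)
    have hemb := primeCounting_shift_le_half_count (y := y) (by omega)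
    have hembr : (Nat.primeCounting (2 * y - 3) : ℝ) + 1 ≤ #{b ∈ Ioc 0 y | b ∈ B} := by exact_mod_cast hemb
    refine le_trans ?_ hembr
    by_cases h67 : 67 ≤ 2 * y - 3
    · have hπ : 1 * ((2 * y - 3 : ℕ) : ℝ) / Real.log ((2 * y - 3 : ℕ) : ℝ)
          ≤ (Nat.primeCounting (2 * y - 3) : ℝ) := by
        have := primeCountingLowerMul_one_of_RS hRS
        unfold PrimeCountingLowerMul at this
        exact this (2 * y - 3) h67
      rw [one_mul] at hπ
      have h2 : ((2 * y - 3 : ℕ) : ℝ) / L₁ ≤ ((2 * y - 3 : ℕ) : ℝ) / Real.log ((2 * y - 3 : ℕ) : ℝ) :=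
        div_le_div_of_nonneg_left hn0.le hlogpos hmid
      have h3 : (y : ℝ) / h ≤ 2 * y / L₁ := by
        rw [div_le_div_iff₀ hh0 hL₁pos]
        nlinarith [mul_le_mul_of_nonneg_left hL₁h hy0.le]
      have h4 : 2 * (y : ℝ) / L₁ ≤ ((2 * y - 3 : ℕ) : ℝ) / L₁ + 1 := by
        rw [hnr]
        have e : (2 * (y : ℝ) - 3) / L₁ = 2 * y / L₁ - 3 / L₁ := by
          field_simp
        rw [e]
        have : 3 / L₁ ≤ 1 := by
          rw [div_le_one hL₁pos]
          linarith
        linarith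
      linarith [h2, h3, h4, hπ]
    · rw [not_le] at h67
      have hn32 : 32 ≤ 2 * y - 3 := by omega
      have hπ := ShnirelmanGoldbachTheorem.primeCounting_ge hn32
      have hlog7 : Real.log ((2 * y - 3 : ℕ) : ℝ) ≤ 7 := by
        have hy7 : ((2 * y - 3 : ℕ) : ℝ) ≤ (2 : ℝ) ^ 7 := by
          have : ((2 * y - 3 : ℕ) : ℝ) < 67 := by exact_mod_cast h67
          have h27 : (67 : ℝ) ≤ (2 : ℝ) ^ 7 := by norm_num
          linarith
        have he : (2 : ℝ) ≤ Real.exp 1 := by have := Real.add_one_le_exp (1 : ℝ); linarith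
        have h7 : (2 : ℝ) ^ 7 ≤ Real.exp 7 := by
          rw [show (7 : ℝ) = ((7 : ℕ) : ℝ) * 1 by norm_num, Real.exp_nat_mul]
          exact pow_le_pow_left₀ (by norm_num) he 7
        have := Real.log_le_log hn0 (hy7.trans h7)
        rwa [Real.log_exp] at this
      have h5 : ((2 * y - 3 : ℕ) : ℝ) / 28 ≤ ((2 * y - 3 : ℕ) : ℝ) / (4 * Real.log ((2 * y - 3 : ℕ) : ℝ)) :=
        div_le_div_of_nonneg_left hn0.le (by positivity) (by linarith)
      have h6' : (y : ℝ) / h ≤ (y : ℝ) / 18 := div_le_div_of_nonneg_left hy0.le (by norm_num) hhr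
      have h7 : ((2 * y - 3 : ℕ) : ℝ) / 28 + 1 - (y : ℝ) / 18 = (4 * (y : ℝ) + 225) / 252 := by
        rw [hnr]
        ring
      have h8 : 0 ≤ (4 * (y : ℝ) + 225) / 252 := by positivity
      linarith [hπ, h5, h6', h7, h8]
  · -- FOUR SHIFTS on `(e^{L₁}, e^{Λ₀})`, `c₀ = 1`
    rw [not_le] at hmid
    have h59 : (576460752303423488 : ℝ) < ((2 * y - 3 : ℕ) : ℝ) := by
      have h1 : Real.exp L₁ < ((2 * y - 3 : ℕ) : ℝ) := by
        by_contra hc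
        rw [not_lt] at hc
        have := Real.log_le_log hn0 hc
        rw [Real.log_exp] at this
        linarith
      exact lt_of_le_of_lt (numeral_le_exp_41.trans (Real.exp_le_exp.mpr h41)) h1
    have h59n : 576460752303423488 < 2 * y - 3 := by exact_mod_cast h59
    have hy58 : (288230376151711744 : ℝ) ≤ (y : ℝ) := by
      have : 288230376151711744 ≤ y := by omega
      exact_mod_cast this
    have h2y0 : (0 : ℝ) < ((2 * y : ℕ) : ℝ) := by push_cast; linarith
    set L := Real.log ((2 * y : ℕ) : ℝ) with hLdef
    have hLΛ : L < Λ₀ := by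
      have := Real.log_lt_log h2y0 hbig
      rwa [Real.log_exp] at this
    have hL₁L : L₁ ≤ L := by
      have h2y : ((2 * y - 3 : ℕ) : ℝ) ≤ ((2 * y : ℕ) : ℝ) := by rw [hnr]; push_cast; linarith
      exact (hmid.trans_le (Real.log_le_log hn0 h2y)).le
    have hL41 : (41 : ℝ) ≤ L := h41.trans hL₁L
    have hLpos : (0 : ℝ) < L := by linarith
    have hL4 : L ≤ 10000 := by linarith
    have he41 : Real.exp 41 ≤ ((2 * y : ℕ) : ℝ) := by
      have : Real.exp 41 ≤ Real.exp L := Real.exp_le_exp.mpr hL41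
      rwa [hLdef, Real.exp_log h2y0] at this
    have hπ : ∀ q : ℕ, q ≤ 41 → (2 * (y : ℝ) - q) / L ≤ (Nat.primeCounting (2 * y - q) : ℝ) := by
      intro q hq
      have hqr : (q : ℝ) ≤ 41 := by exact_mod_cast hq
      have hnq : ((2 * y - q : ℕ) : ℝ) = 2 * (y : ℝ) - q := cast_two_mul_sub (by omega)
      have h67 : 67 ≤ 2 * y - q := by omega
      have hnq0 : (0 : ℝ) < ((2 * y - q : ℕ) : ℝ) := by rw [hnq]; linarith
      have hnq1 : (1 : ℝ) < ((2 * y - q : ℕ) : ℝ) := by rw [hnq]; linarith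
      have h1 : 1 * ((2 * y - q : ℕ) : ℝ) / Real.log ((2 * y - q : ℕ) : ℝ)
          ≤ (Nat.primeCounting (2 * y - q) : ℝ) := by
        have := primeCountingLowerMul_one_of_RS hRS
        unfold PrimeCountingLowerMul at this
        exact this (2 * y - q) h67
      rw [one_mul] at h1
      have hlogq0 : 0 < Real.log ((2 * y - q : ℕ) : ℝ) := Real.log_pos hnq1
      have hlogq : Real.log ((2 * y - q : ℕ) : ℝ) ≤ L := by
        have h2y : ((2 * y - q : ℕ) : ℝ) ≤ ((2 * y : ℕ) : ℝ) := by
          rw [hnq]; push_cast; linarith [Nat.cast_nonneg (α := ℝ) q]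
        exact Real.log_le_log hnq0 h2y
      have h2 : (2 * (y : ℝ) - q) / L ≤ ((2 * y - q : ℕ) : ℝ) / Real.log ((2 * y - q : ℕ) : ℝ) := by
        rw [← hnq]
        exact div_le_div_of_nonneg_left hnq0.le hlogq0 hlogq
      linarith
    have hP : ∀ d : ℕ, d ≠ 0 → Even d →
        (#((Nat.primesLE (2 * y)).filter (fun p => (p + d).Prime)) : ℝ)
          ≤ 16.93 * oddSingularFactor d * ((2 * y : ℕ) : ℝ) / L ^ 2 := by
      intro d hd hde
      exact pairCount_le_1693 (N := 2 * y) (h := d) he41 hd hde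
    rcases le_or_gt L L₂ with hmid2 | hmid2
    · -- FOUR SHIFTS on `(e^{L₁}, e^{L₂}]`
      have hq := hquad L hL₁L hmid2
      have hP2 := hP 2 (by norm_num) (by norm_num)
      have hP4 := hP 4 (by norm_num) (by norm_num)
      have hP6 := hP 6 (by norm_num) (by norm_num)
      have hP8 := hP 8 (by norm_num) (by norm_num)
      rw [oddSingularFactor_two'] at hP2
      rw [oddSingularFactor_four] at hP4
      rw [oddSingularFactor_six] at hP6
      rw [oddSingularFactor_eight] at hP8
      have hcomb := four_shift_count (y := y) (by omega)
      have hcombr : (Nat.primeCounting (2 * y - 3) : ℝ) + Nat.primeCounting (2 * y - 5)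
          + Nat.primeCounting (2 * y - 7) + Nat.primeCounting (2 * y - 11)
          ≤ (#{b ∈ Ioc 0 y | b ∈ B} : ℝ) + 2
            + (2 * #((Nat.primesLE (2 * y)).filter (fun p => (p + 2).Prime))
              + 2 * #((Nat.primesLE (2 * y)).filter (fun p => (p + 4).Prime))
              + #((Nat.primesLE (2 * y)).filter (fun p => (p + 8).Prime))
              + #((Nat.primesLE (2 * y)).filter (fun p => (p + 6).Prime))) := by
        exact_mod_cast hcomb
      have hπ3 := hπ 3 (by norm_num)
      have hπ5 := hπ 5 (by norm_num)
      have hπ7 := hπ 7 (by norm_num)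
      have hπ11 := hπ 11 (by norm_num)
      push_cast at hπ3 hπ5 hπ7 hπ11
      have h2yr : ((2 * y : ℕ) : ℝ) = 2 * (y : ℝ) := by push_cast; ring
      rw [h2yr] at hP2 hP4 hP6 hP8
      set G : ℝ := (#{b ∈ Ioc 0 y | b ∈ B} : ℝ) with hG
      set Y : ℝ := (y : ℝ) with hY
      have hG1 : (8 * Y - 26) / L - 2 - 237.02 * Y / L ^ 2 ≤ G := by
        have e1 : (8 * Y - 26) / L = (2 * Y - 3) / L + (2 * Y - 5) / L + (2 * Y - 7) / L + (2 * Y - 11) / L := by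
          field_simp
          ring
        have e2 : 237.02 * Y / L ^ 2 = 2 * (16.93 * 1 * (2 * Y) / L ^ 2) + 2 * (16.93 * 1 * (2 * Y) / L ^ 2)
            + 16.93 * 1 * (2 * Y) / L ^ 2 + 16.93 * 2 * (2 * Y) / L ^ 2 := by
          field_simp
          ring
        rw [e1, e2]
        linarith [hcombr, hπ3, hπ5, hπ7, hπ11, hP2, hP4, hP6, hP8]
      have hL2 : (0 : ℝ) < L ^ 2 := by positivity
      have hkey : Y * L ^ 2 ≤ (h : ℝ) * G * L ^ 2 := by
        have e3 : ((8 * Y - 26) / L - 2 - 237.02 * Y / L ^ 2) * L ^ 2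
            = 8 * Y * L - 26 * L - 2 * L ^ 2 - 237.02 * Y := by
          field_simp
        have h1 : (8 * Y * L - 26 * L - 2 * L ^ 2 - 237.02 * Y) * h ≤ G * L ^ 2 * h := by
          rw [← e3]
          exact mul_le_mul_of_nonneg_right (mul_le_mul_of_nonneg_right hG1 hL2.le) hh0.le
        have h2 : Y * (L ^ 2 + h) ≤ Y * (h * (8 * L - 237.02)) :=
          mul_le_mul_of_nonneg_left hq (by linarith)
        have h3 : 26 * L + 2 * L ^ 2 ≤ Y := by
          nlinarith [mul_nonneg (sub_nonneg.2 hL4) hLpos.le]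
        have h3' : (h : ℝ) * (26 * L + 2 * L ^ 2) ≤ h * Y := mul_le_mul_of_nonneg_left h3 hh0.le
        nlinarith [h1, h2, h3']
      have hfin := le_of_mul_le_mul_right hkey hL2
      rw [div_le_iff₀ hh0, mul_comm]
      exact hfin
    · rcases le_or_gt L L₃ with hmid3 | hmid3
      · -- SEVEN SHIFTS on `(e^{L₂}, e^{L₃}]`
        have hq := hquad7 L hmid2.le hmid3
        have he125 : Real.exp 125 ≤ ((2 * y : ℕ) : ℝ) := by
          have : Real.exp 125 ≤ Real.exp L := Real.exp_le_exp.mpr (hL₂.trans hmid2.le)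
          rwa [hLdef, Real.exp_log h2y0] at this
        have hP7 : ∀ d : ℕ, d ≠ 0 → Even d →
            (#((Nat.primesLE (2 * y)).filter (fun p => (p + d).Prime)) : ℝ)
              ≤ 13.12 * oddSingularFactor d * ((2 * y : ℕ) : ℝ) / L ^ 2 := by
          intro d hd hde
          rw [hLdef]
          exact pairCount_le_1312 (N := 2 * y) (h := d) he125 hd hde
        have hP2 := hP7 2 (by norm_num) (by norm_num)
        have hP4 := hP7 4 (by norm_num) (by norm_num)
        have hP6 := hP7 6 (by norm_num) (by norm_num)
        have hP8 := hP7 8 (by norm_num) (by norm_num)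
        have hP10 := hP7 10 (by norm_num) (by norm_num)
        have hP12 := hP7 12 (by norm_num) (by norm_num)
        have hP14 := hP7 14 (by norm_num) (by norm_num)
        have hP16 := hP7 16 (by norm_num) (by norm_num)
        rw [oddSingularFactor_two'] at hP2
        rw [oddSingularFactor_four] at hP4
        rw [oddSingularFactor_six] at hP6
        rw [oddSingularFactor_eight] at hP8
        rw [oddSingularFactor_ten] at hP10
        rw [oddSingularFactor_twelve] at hP12
        rw [oddSingularFactor_fourteen] at hP14
        rw [oddSingularFactor_sixteen] at hP16
        have hcomb := seven_shift_count (y := y) (by omega)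
        have hcombr : (Nat.primeCounting (2 * y - 3) : ℝ) + Nat.primeCounting (2 * y - 5)
            + Nat.primeCounting (2 * y - 7) + Nat.primeCounting (2 * y - 11) + Nat.primeCounting (2 * y - 13)
            + Nat.primeCounting (2 * y - 17) + Nat.primeCounting (2 * y - 19)
            ≤ (#{b ∈ Ioc 0 y | b ∈ B} : ℝ) + 5
              + (4 * #((Nat.primesLE (2 * y)).filter (fun p => (p + 2).Prime))
                + 3 * #((Nat.primesLE (2 * y)).filter (fun p => (p + 4).Prime))
                + 4 * #((Nat.primesLE (2 * y)).filter (fun p => (p + 6).Prime))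
                + 3 * #((Nat.primesLE (2 * y)).filter (fun p => (p + 8).Prime))
                + 2 * #((Nat.primesLE (2 * y)).filter (fun p => (p + 10).Prime))
                + 2 * #((Nat.primesLE (2 * y)).filter (fun p => (p + 12).Prime))
                + 2 * #((Nat.primesLE (2 * y)).filter (fun p => (p + 14).Prime))
                + #((Nat.primesLE (2 * y)).filter (fun p => (p + 16).Prime))) := by
          exact_mod_cast hcomb
        have hπ3 := hπ 3 (by norm_num)
        have hπ5 := hπ 5 (by norm_num)
        have hπ7 := hπ 7 (by norm_num)
        have hπ11 := hπ 11 (by norm_num)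
        have hπ13 := hπ 13 (by norm_num)
        have hπ17 := hπ 17 (by norm_num)
        have hπ19 := hπ 19 (by norm_num)
        push_cast at hπ3 hπ5 hπ7 hπ11 hπ13 hπ17 hπ19
        have h2yr : ((2 * y : ℕ) : ℝ) = 2 * (y : ℝ) := by push_cast; ring
        rw [h2yr] at hP2 hP4 hP6 hP8 hP10 hP12 hP14 hP16
        set G : ℝ := (#{b ∈ Ioc 0 y | b ∈ B} : ℝ) with hG
        set Y : ℝ := (y : ℝ) with hY
        have hY0 : 0 ≤ Y := le_trans (by norm_num) hy58
        have hL2 : (0 : ℝ) < L ^ 2 := by positivity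
        have hG1 : (14 * Y - 75) / L - 5 - 736.5 * Y / L ^ 2 ≤ G := by
          have e1 : (14 * Y - 75) / L
              = (2 * Y - 3) / L + (2 * Y - 5) / L + (2 * Y - 7) / L + (2 * Y - 11) / L + (2 * Y - 13) / L + (2 * Y - 17) / L + (2 * Y - 19) / L := by
            field_simp
            ring
          have e2 : 4 * (13.12 * 1 * (2 * Y) / L ^ 2) + 3 * (13.12 * 1 * (2 * Y) / L ^ 2)
              + 4 * (13.12 * 2 * (2 * Y) / L ^ 2) + 3 * (13.12 * 1 * (2 * Y) / L ^ 2)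
              + 2 * (13.12 * (4 / 3) * (2 * Y) / L ^ 2) + 2 * (13.12 * 2 * (2 * Y) / L ^ 2)
              + 2 * (13.12 * (6 / 5) * (2 * Y) / L ^ 2) + 13.12 * 1 * (2 * Y) / L ^ 2
              = (276176 / 375) * Y / L ^ 2 := by
            field_simp
            ring
          have e3 : (276176 / 375 : ℝ) * Y / L ^ 2 ≤ 736.5 * Y / L ^ 2 :=
            div_le_div_of_nonneg_right (mul_le_mul_of_nonneg_right (by norm_num) hY0) hL2.le
          rw [e1]
          linarith [hcombr, hπ3, hπ5, hπ7, hπ11, hπ13, hπ17, hπ19, hP2, hP4, hP6, hP8, hP10, hP12, hP14, hP16,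
            e2, e3]
        have hkey : Y * L ^ 2 ≤ (h : ℝ) * G * L ^ 2 := by
          have e4 : ((14 * Y - 75) / L - 5 - 736.5 * Y / L ^ 2) * L ^ 2
              = 14 * Y * L - 75 * L - 5 * L ^ 2 - 736.5 * Y := by
            field_simp
          have h1 : (14 * Y * L - 75 * L - 5 * L ^ 2 - 736.5 * Y) * h ≤ G * L ^ 2 * h := by
            rw [← e4]
            exact mul_le_mul_of_nonneg_right (mul_le_mul_of_nonneg_right hG1 hL2.le) hh0.le
          have h2 : Y * (L ^ 2 + h) ≤ Y * (h * (14 * L - 736.5)) :=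
            mul_le_mul_of_nonneg_left hq (by linarith)
          have h3 : 75 * L + 5 * L ^ 2 ≤ Y := by
            nlinarith [mul_nonneg (sub_nonneg.2 hL4) hLpos.le]
          have h3' : (h : ℝ) * (75 * L + 5 * L ^ 2) ≤ h * Y := mul_le_mul_of_nonneg_left h3 hh0.le
          nlinarith [h1, h2, h3']
        have hfin := le_of_mul_le_mul_right hkey hL2
        rw [div_le_iff₀ hh0, mul_comm]
        exact hfin
      · -- TWELVE SHIFTS on `(e^{L₃}, e^{Λ₀})`, pair sieve at the threshold `e^215`
        have hq := hquad12 L hmid3.le hLΛ.le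
        have he215 : Real.exp 215 ≤ ((2 * y : ℕ) : ℝ) := by
          have : Real.exp 215 ≤ Real.exp L := Real.exp_le_exp.mpr (hL₃.trans hmid3.le)
          rwa [hLdef, Real.exp_log h2y0] at this
        have hPt : ∀ d : ℕ, d ≠ 0 → Even d →
            (#((Nat.primesLE (2 * y)).filter (fun p => (p + d).Prime)) : ℝ)
              ≤ 12.42 * oddSingularFactor d * ((2 * y : ℕ) : ℝ) / L ^ 2 := by
          intro d hd hde
          rw [hLdef]
          exact pairCount_le_1242 (N := 2 * y) (h := d) he215 hd hde
        have hQ2 := hPt 2 (by norm_num) (by norm_num)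
        have hQ4 := hPt 4 (by norm_num) (by norm_num)
        have hQ6 := hPt 6 (by norm_num) (by norm_num)
        have hQ8 := hPt 8 (by norm_num) (by norm_num)
        have hQ10 := hPt 10 (by norm_num) (by norm_num)
        have hQ12 := hPt 12 (by norm_num) (by norm_num)
        have hQ14 := hPt 14 (by norm_num) (by norm_num)
        have hQ16 := hPt 16 (by norm_num) (by norm_num)
        have hQ18 := hPt 18 (by norm_num) (by norm_num)
        have hQ20 := hPt 20 (by norm_num) (by norm_num)
        have hQ22 := hPt 22 (by norm_num) (by norm_num)
        have hQ24 := hPt 24 (by norm_num) (by norm_num)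
        have hQ26 := hPt 26 (by norm_num) (by norm_num)
        have hQ28 := hPt 28 (by norm_num) (by norm_num)
        have hQ30 := hPt 30 (by norm_num) (by norm_num)
        have hQ32 := hPt 32 (by norm_num) (by norm_num)
        have hQ34 := hPt 34 (by norm_num) (by norm_num)
        have hQ36 := hPt 36 (by norm_num) (by norm_num)
        have hQ38 := hPt 38 (by norm_num) (by norm_num)
        rw [oddSingularFactor_two'] at hQ2
        rw [oddSingularFactor_four] at hQ4
        rw [oddSingularFactor_six] at hQ6
        rw [oddSingularFactor_eight] at hQ8
        rw [oddSingularFactor_ten] at hQ10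
        rw [oddSingularFactor_twelve] at hQ12
        rw [oddSingularFactor_fourteen] at hQ14
        rw [oddSingularFactor_sixteen] at hQ16
        rw [oddSingularFactor_eighteen] at hQ18
        rw [oddSingularFactor_twenty] at hQ20
        rw [oddSingularFactor_twentytwo] at hQ22
        rw [oddSingularFactor_twentyfour] at hQ24
        rw [oddSingularFactor_twentysix] at hQ26
        rw [oddSingularFactor_twentyeight] at hQ28
        rw [oddSingularFactor_thirty] at hQ30
        rw [oddSingularFactor_thirtytwo] at hQ32
        rw [oddSingularFactor_thirtyfour] at hQ34
        rw [oddSingularFactor_thirtysix] at hQ36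
        rw [oddSingularFactor_thirtyeight] at hQ38
        have hcomb := twelve_shift_count (y := y) (by omega)
        have hcombr : (Nat.primeCounting (2 * y - 3) : ℝ) + Nat.primeCounting (2 * y - 5)
            + Nat.primeCounting (2 * y - 7) + Nat.primeCounting (2 * y - 11) + Nat.primeCounting (2 * y - 13)
            + Nat.primeCounting (2 * y - 17) + Nat.primeCounting (2 * y - 19) + Nat.primeCounting (2 * y - 23)
            + Nat.primeCounting (2 * y - 29) + Nat.primeCounting (2 * y - 31) + Nat.primeCounting (2 * y - 37)
            + Nat.primeCounting (2 * y - 41)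
            ≤ (#{b ∈ Ioc 0 y | b ∈ (({0, 1} : Set ℕ) ∪ {m | ∃ p q : ℕ, p.Prime ∧ q.Prime ∧ p + q = 2 * m})} : ℝ) + 10
              + (5 * #((Nat.primesLE (2 * y)).filter (fun p => (p + 2).Prime))
                + 5 * #((Nat.primesLE (2 * y)).filter (fun p => (p + 4).Prime))
                + 7 * #((Nat.primesLE (2 * y)).filter (fun p => (p + 6).Prime))
                + 5 * #((Nat.primesLE (2 * y)).filter (fun p => (p + 8).Prime))
                + 5 * #((Nat.primesLE (2 * y)).filter (fun p => (p + 10).Prime))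
                + 6 * #((Nat.primesLE (2 * y)).filter (fun p => (p + 12).Prime))
                + 4 * #((Nat.primesLE (2 * y)).filter (fun p => (p + 14).Prime))
                + 3 * #((Nat.primesLE (2 * y)).filter (fun p => (p + 16).Prime))
                + 5 * #((Nat.primesLE (2 * y)).filter (fun p => (p + 18).Prime))
                + 3 * #((Nat.primesLE (2 * y)).filter (fun p => (p + 20).Prime))
                + 2 * #((Nat.primesLE (2 * y)).filter (fun p => (p + 22).Prime))
                + 4 * #((Nat.primesLE (2 * y)).filter (fun p => (p + 24).Prime))
                + 3 * #((Nat.primesLE (2 * y)).filter (fun p => (p + 26).Prime))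
                + 2 * #((Nat.primesLE (2 * y)).filter (fun p => (p + 28).Prime))
                + 2 * #((Nat.primesLE (2 * y)).filter (fun p => (p + 30).Prime))
                + #((Nat.primesLE (2 * y)).filter (fun p => (p + 32).Prime))
                + 2 * #((Nat.primesLE (2 * y)).filter (fun p => (p + 34).Prime))
                + #((Nat.primesLE (2 * y)).filter (fun p => (p + 36).Prime))
                + #((Nat.primesLE (2 * y)).filter (fun p => (p + 38).Prime))) := by
          exact_mod_cast hcomb
        have hπ3 := hπ 3 (by norm_num)
        have hπ5 := hπ 5 (by norm_num)
        have hπ7 := hπ 7 (by norm_num)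
        have hπ11 := hπ 11 (by norm_num)
        have hπ13 := hπ 13 (by norm_num)
        have hπ17 := hπ 17 (by norm_num)
        have hπ19 := hπ 19 (by norm_num)
        have hπ23 := hπ 23 (by norm_num)
        have hπ29 := hπ 29 (by norm_num)
        have hπ31 := hπ 31 (by norm_num)
        have hπ37 := hπ 37 (by norm_num)
        have hπ41 := hπ 41 (by norm_num)
        push_cast at hπ3 hπ5 hπ7 hπ11 hπ13 hπ17 hπ19 hπ23 hπ29 hπ31 hπ37 hπ41
        have h2yr : ((2 * y : ℕ) : ℝ) = 2 * (y : ℝ) := by push_cast; ring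
        rw [h2yr] at hQ2 hQ4 hQ6 hQ8 hQ10 hQ12 hQ14 hQ16 hQ18 hQ20 hQ22 hQ24 hQ26 hQ28 hQ30 hQ32 hQ34 hQ36 hQ38
        set G : ℝ := (#{b ∈ Ioc 0 y | b ∈ (({0, 1} : Set ℕ) ∪ {m | ∃ p q : ℕ, p.Prime ∧ q.Prime ∧ p + q = 2 * m})} : ℝ) with hG
        set Y : ℝ := (y : ℝ) with hY
        have hY0 : 0 ≤ Y := le_trans (by norm_num) hy58
        have hL2 : (0 : ℝ) < L ^ 2 := by positivity
        have hG1 : (24 * Y - 236) / L - 10 - 2407 * Y / L ^ 2 ≤ G := by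
          have e1 : (24 * Y - 236) / L
              = (2 * Y - 3) / L + (2 * Y - 5) / L + (2 * Y - 7) / L + (2 * Y - 11) / L
                + (2 * Y - 13) / L + (2 * Y - 17) / L + (2 * Y - 19) / L + (2 * Y - 23) / L
                + (2 * Y - 29) / L + (2 * Y - 31) / L + (2 * Y - 37) / L + (2 * Y - 41) / L := by
            field_simp
            ring
          have e2 : 5 * (12.42 * 1 * (2 * Y) / L ^ 2)
              + 5 * (12.42 * 1 * (2 * Y) / L ^ 2)
              + 7 * (12.42 * 2 * (2 * Y) / L ^ 2)
              + 5 * (12.42 * 1 * (2 * Y) / L ^ 2)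
              + 5 * (12.42 * (4 / 3) * (2 * Y) / L ^ 2)
              + 6 * (12.42 * 2 * (2 * Y) / L ^ 2)
              + 4 * (12.42 * (6 / 5) * (2 * Y) / L ^ 2)
              + 3 * (12.42 * 1 * (2 * Y) / L ^ 2)
              + 5 * (12.42 * 2 * (2 * Y) / L ^ 2)
              + 3 * (12.42 * (4 / 3) * (2 * Y) / L ^ 2)
              + 2 * (12.42 * (10 / 9) * (2 * Y) / L ^ 2)
              + 4 * (12.42 * 2 * (2 * Y) / L ^ 2)
              + 3 * (12.42 * (12 / 11) * (2 * Y) / L ^ 2)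
              + 2 * (12.42 * (6 / 5) * (2 * Y) / L ^ 2)
              + 2 * (12.42 * (8 / 3) * (2 * Y) / L ^ 2)
              + 12.42 * 1 * (2 * Y) / L ^ 2
              + 2 * (12.42 * (16 / 15) * (2 * Y) / L ^ 2)
              + 12.42 * 2 * (2 * Y) / L ^ 2
              + 12.42 * (18 / 17) * (2 * Y) / L ^ 2
              = (11251209 / 4675) * Y / L ^ 2 := by
            field_simp
            ring
          have e3 : (11251209 / 4675 : ℝ) * Y / L ^ 2 ≤ 2407 * Y / L ^ 2 :=
            div_le_div_of_nonneg_right (mul_le_mul_of_nonneg_right (by norm_num) hY0) hL2.le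
          rw [e1]
          linarith [hcombr, hπ3, hπ5, hπ7, hπ11, hπ13, hπ17, hπ19, hπ23, hπ29, hπ31, hπ37, hπ41,
            hQ2, hQ4, hQ6, hQ8, hQ10, hQ12, hQ14, hQ16, hQ18, hQ20, hQ22, hQ24, hQ26, hQ28, hQ30, hQ32, hQ34, hQ36, hQ38, e2, e3]
        have hkey : Y * L ^ 2 ≤ (h : ℝ) * G * L ^ 2 := by
          have e4 : ((24 * Y - 236) / L - 10 - 2407 * Y / L ^ 2) * L ^ 2
              = 24 * Y * L - 236 * L - 10 * L ^ 2 - 2407 * Y := by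
            field_simp
          have h1 : (24 * Y * L - 236 * L - 10 * L ^ 2 - 2407 * Y) * h ≤ G * L ^ 2 * h := by
            rw [← e4]
            exact mul_le_mul_of_nonneg_right (mul_le_mul_of_nonneg_right hG1 hL2.le) hh0.le
          have h2 : Y * (L ^ 2 + h) ≤ Y * (h * (24 * L - 2407)) :=
            mul_le_mul_of_nonneg_left hq (by linarith)
          have h3 : 236 * L + 10 * L ^ 2 ≤ Y := by
            nlinarith [mul_nonneg (sub_nonneg.2 hL4) hLpos.le]
          have h3' : (h : ℝ) * (236 * L + 10 * L ^ 2) ≤ h * Y := mul_le_mul_of_nonneg_left h3 hh0.le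
          nlinarith [h1, h2, h3']
        have hfin := le_of_mul_le_mul_right hkey hL2
        rw [div_le_iff₀ hh0, mul_comm]
        exact hfin

/-! ### §22.4 Instances: the count at `(Λs, Λ₀, A) = (352, 364, 12.04)`, the glues with `h = 23` / `21`, densities, Mann -/

/-- **Unconditional, above `e^364`**: at least `x/46` EVEN Goldbach numbers in `(0, x]` (`J = 400` levels; `Λs = 352`,
`A = 12.04` from the `c = 16` enlarged-cell sieve, `c₁ = 0.441`; `(1/46)⁷·259.55·12.04⁸ = 0.2630 ≤ (0.4409·gHol4 364 − 0.0057)⁸ = 0.3017`).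
[cite: Nathanson1996, Theorem 7.8 (proof, restricted to even N; explicit form proved here)] -/
theorem goldbach_even_count_ge_46_exp364 {x : ℕ} (hx : Real.exp 364 ≤ (x : ℝ)) :
    (x : ℝ) / 46 ≤ #{N ∈ Ioc 0 x | Even N ∧ ∃ p q : ℕ, p.Prime ∧ q.Prime ∧ p + q = N} := by
  have h := goldbach_even_count_ge_holder400 (Λs := 352) (Λ₀ := 364) (A := 12.04) (c₁ := 0.441) (κ := 1 / 46)
    (by norm_num) (by norm_num) (by norm_num) (by norm_num) (by norm_num)
    (fun N hN hev => goldbachCount_le_1204 hN hev) (by norm_num) (by norm_num)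
    (fun y hy => sum_goldbachCount_ge_0441 ((Real.exp_le_exp.mpr (by norm_num)).trans hy))
    (by unfold gHol4; norm_num) (by unfold gHol4; norm_num) hx
  have e : (1 : ℝ) / 46 * x = x / 46 := by ring
  rw [e] at h
  exact h

/-- **Under (3.3), above `e^364`**: at least `x/42` EVEN Goldbach numbers in `(0, x]` (`Λs = 352`, `A = 12.04`,
`c₁ = 0.4995`; `(1/42)⁷·259.55·12.04⁸ = 0.4972 ≤ (0.4994·gHol4 364 − 0.0057)⁸ = 0.8238`).
[cite: RosserSchoenfeld1962, Theorem 2, eq. (3.3) (as input)] -/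
theorem goldbach_even_count_ge_of_RS_42 (hRS : Literature.NumberTheory.LFunctions.RosserSchoenfeld1962_theorem2)
    {x : ℕ} (hx : Real.exp 364 ≤ (x : ℝ)) :
    (x : ℝ) / 42 ≤ #{N ∈ Ioc 0 x | Even N ∧ ∃ p q : ℕ, p.Prime ∧ q.Prime ∧ p + q = N} := by
  have h := goldbach_even_count_ge_holder400 (Λs := 352) (Λ₀ := 364) (A := 12.04) (c₁ := 0.4995) (κ := 1 / 42)
    (by norm_num) (by norm_num) (by norm_num) (by norm_num) (by norm_num)
    (fun N hN hev => goldbachCount_le_1204 hN hev) (by norm_num) (by norm_num)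
    (fun y hy => sum_goldbachCount_ge_of_RS' hRS ((Real.exp_le_exp.mpr (by norm_num)).trans hy))
    (by unfold gHol4; norm_num) (by unfold gHol4; norm_num) hx
  have e : (1 : ℝ) / 42 * x = x / 42 := by ring
  rw [e] at h
  exact h

/-- **Unconditional count for all `y ≥ 1`**: `B(y) ≥ y/23` (one shift below `e^42.37 ≤ e^{1.8424·23}`, four shifts on
`[42.37, 125]` (pair sieve `16.93`), seven on `[125, 215]` (`13.12`), twelve on `[215, 364]` (`12.42`), the count above
`e^364`; windows `[41.8, 131.0]`, `[74.4, 228.0]`, `[150.6, 367.9]`). [cite: Nathanson1996, Theorem 7.8 (explicit constant for the halved set proved here)] -/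
theorem half_count_ge_allN_23 {y : ℕ} (hy : 1 ≤ y) :
    (y : ℝ) / 23 ≤ #{b ∈ Ioc 0 y | b ∈ (({0, 1} : Set ℕ) ∪ {m | ∃ p q : ℕ, p.Prime ∧ q.Prime ∧ p + q = 2 * m})} := by
  have h := half_count_ge_allN_cells (L₁ := 42.37) (L₂ := 125) (L₃ := 215) (Λ₀ := 364) (h := 23) (by norm_num)
    (by norm_num) (by norm_num) (by norm_num) (by norm_num) (by norm_num)
    (fun L h1 h2 => by
      push_cast
      nlinarith [mul_nonneg (sub_nonneg.2 h1) (sub_nonneg.2 h2)])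
    (fun L h1 h2 => by
      push_cast
      nlinarith [mul_nonneg (sub_nonneg.2 h1) (sub_nonneg.2 h2)])
    (fun L h1 h2 => by
      push_cast
      nlinarith [mul_nonneg (sub_nonneg.2 h1) (sub_nonneg.2 h2)])
    (fun x hx => by
      have h1 := goldbach_even_count_ge_46_exp364 hx
      have e : (x : ℝ) / (2 * ((23 : ℕ) : ℝ)) = (x : ℝ) / 46 := by norm_num
      rw [e]
      exact h1) hy
  exact_mod_cast h

/-- **Under (3.3), all `y ≥ 1`**: `B(y) ≥ y/21` (one shift below `e^42`, four shifts on `[42, 125]`, seven on `[125, 215]`,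
twelve on `[215, 364]`, the count above `e^364`; windows `[38.6, 129.4]`, `[68.0, 226.0]`, `[138.3, 365.7]`).
[cite: RosserSchoenfeld1962, Theorem 2, eq. (3.3) (as input)] -/
theorem half_count_ge_allN_of_RS_21 (hRS : Literature.NumberTheory.LFunctions.RosserSchoenfeld1962_theorem2)
    {y : ℕ} (hy : 1 ≤ y) :
    (y : ℝ) / 21 ≤ #{b ∈ Ioc 0 y | b ∈ (({0, 1} : Set ℕ) ∪ {m | ∃ p q : ℕ, p.Prime ∧ q.Prime ∧ p + q = 2 * m})} := by
  have h := half_count_ge_allN_cells_RS hRS (L₁ := 42) (L₂ := 125) (L₃ := 215) (Λ₀ := 364) (h := 21) (by norm_num)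
    (by norm_num) (by norm_num) (by norm_num) (by norm_num) (by norm_num)
    (fun L h1 h2 => by
      push_cast
      nlinarith [mul_nonneg (sub_nonneg.2 h1) (sub_nonneg.2 h2)])
    (fun L h1 h2 => by
      push_cast
      nlinarith [mul_nonneg (sub_nonneg.2 h1) (sub_nonneg.2 h2)])
    (fun L h1 h2 => by
      push_cast
      nlinarith [mul_nonneg (sub_nonneg.2 h1) (sub_nonneg.2 h2)])
    (fun x hx => by
      have h1 := goldbach_even_count_ge_of_RS_42 hRS hx
      have e : (x : ℝ) / (2 * ((21 : ℕ) : ℝ)) = (x : ℝ) / 42 := by norm_num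
      rw [e]
      exact h1) hy
  exact_mod_cast h

/-- **The halved density, `1/23`**: `σ({0, 1} ∪ {m : 2m = p + q}) ≥ 1/23`, unconditionally. [cite: Nathanson1996, Theorem 7.8 (explicit constant for the halved set proved here)] -/
theorem schnirelmannDensity_half_ge_23 :
    (1 : ℝ) / 23 ≤ schnirelmannDensity
      (({0, 1} : Set ℕ) ∪ {m | ∃ p q : ℕ, p.Prime ∧ q.Prime ∧ p + q = 2 * m}) := by
  have h := schnirelmannDensity_ge_of_count' (K := 23)
    (S := ({0, 1} : Set ℕ) ∪ {m | ∃ p q : ℕ, p.Prime ∧ q.Prime ∧ p + q = 2 * m})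
    (fun N hN => by have := half_count_ge_allN_23 hN; exact_mod_cast this)
  exact_mod_cast h

/-- **The halved density under (3.3), `1/21`**. [cite: RosserSchoenfeld1962, Theorem 2, eq. (3.3) (as input)] -/
theorem schnirelmannDensity_half_ge_of_RS_21 (hRS : Literature.NumberTheory.LFunctions.RosserSchoenfeld1962_theorem2) :
    (1 : ℝ) / 21 ≤ schnirelmannDensity
      (({0, 1} : Set ℕ) ∪ {m | ∃ p q : ℕ, p.Prime ∧ q.Prime ∧ p + q = 2 * m}) := by
  have h := schnirelmannDensity_ge_of_count' (K := 21)
    (S := ({0, 1} : Set ℕ) ∪ {m | ∃ p q : ℕ, p.Prime ∧ q.Prime ∧ p + q = 2 * m})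
    (fun N hN => by have := half_count_ge_allN_of_RS_21 hRS hN; exact_mod_cast this)
  exact_mod_cast h

/-- ★★★★★★★★★★★★★★★ **The Shnirel'man–Goldbach theorem, explicit and unconditional — the best constant of this file:
every integer `N ≥ 2` is a sum of at most `47` primes** (Selberg main term through the 25-element squarefull cell set
`kappaSet2` (`TlowK2`, leading coefficient `0.3529` instead of `0.3224`): Goldbach sieve `A = 12.04` at `e^352` (`c = 16`),
pair sieves `16.93` / `13.12` / `12.42` above `e^41` / `e^125` / `e^215`; `J = 400` staircase levels; Sylvester's constant;
count `|T| ≥ x/46` above `e^364`; `B(y) ≥ y/23`; halving, Mann: `23 • B = ℕ`, `2·23 + 1`).  No hypotheses, no named facts.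
[cite: Nathanson1996, Thm 7.9 (explicit constant proved here)] -/
theorem schnirelmann_goldbach_le_47 (N : ℕ) (hN : 2 ≤ N) :
    ∃ M : Multiset ℕ, (∀ p ∈ M, p.Prime) ∧ Multiset.card M ≤ 47 ∧ M.sum = N := by
  have hσ : (1 : ℝ) / ((23 : ℕ) : ℝ) ≤ schnirelmannDensity
      (({0, 1} : Set ℕ) ∪ {m | ∃ p q : ℕ, p.Prime ∧ q.Prime ∧ p + q = 2 * m}) := by
    have := schnirelmannDensity_half_ge_23
    exact_mod_cast this
  exact sum_of_primes_of_half_density_mann (h := 23) (by norm_num) hσ N hN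

/-- ★★★★★★★★★★★★★★★ **Under Rosser–Schoenfeld (3.3): every integer `N ≥ 2` is a sum of at most `43` primes** (enlarged
cells, `c = 16` / `c = 8` / `c = 4` sieve lengths, `J = 400` levels, `c₁ = 0.4995`, count `x/42` above `e^364`, four-regime RS
glue with `h = 21`, Mann).
[cite: RosserSchoenfeld1962, Theorem 2, eq. (3.3) (as input); Nathanson1996, Thm 7.9] -/
theorem schnirelmann_goldbach_of_RS_le_43 (hRS : Literature.NumberTheory.LFunctions.RosserSchoenfeld1962_theorem2)
    (N : ℕ) (hN : 2 ≤ N) :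
    ∃ M : Multiset ℕ, (∀ p ∈ M, p.Prime) ∧ Multiset.card M ≤ 43 ∧ M.sum = N := by
  have hσ : (1 : ℝ) / ((21 : ℕ) : ℝ) ≤ schnirelmannDensity
      (({0, 1} : Set ℕ) ∪ {m | ∃ p q : ℕ, p.Prime ∧ q.Prime ∧ p + q = 2 * m}) := by
    have := schnirelmannDensity_half_ge_of_RS_21 hRS
    exact_mod_cast this
  exact sum_of_primes_of_half_density_mann (h := 21) (by norm_num) hσ N hN

end Literature.NumberTheory.Sieve.ShnirelmanGoldbachExplicit
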